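import Literature.MathematicalPhysics.QuantumFieldTheory.Balaban1983to89.B4Lemma22ZeroBoxCube

/-!
# `Balaban1983to89.B4Lemma22ZeroBoxLpLq` — B4 LEMMA 2.2 (2.17) OFF THE DIAGONAL: ALL `1 ≤ p ≤ q ≤ ∞` WITH
# `1/p − 1/q ≤ 1/p₁`, `p₁ > d + 1` (THE LATTICE DIMENSION), FOR THE THREE VECTORS `G_k(□)f`, `D^η_μG_k(□)f`,
# `G_k(□)D^{η*}_μf`, AT `Ã = 0` ON RECTANGULAR PARALLELEPIPEDS, UNIFORMLY IN THE MESH — HENCE b04's TYPED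
# `B4.Lemma22Printed (cubeFam ℓ m²₊ a Mb K) (d + 1)`, BOTH CONJUNCTS VERBATIM, DISCHARGED ON THE ZERO-FIELD BOX FAMILY

**Source.** T. Bałaban, *Regularity and Decay of Lattice Green's Functions*, Commun. Math. Phys. **89**, 571–597
(1983) (bib key `Balaban1983RegularityDecay`, «B4»): pp. 577–578 [PDF 7–8] Lemma 2.2 with (2.16)–(2.17); p. 582
[PDF 12] the representation (2.34); p. 583 [PDF 13] the proof of (2.17) for `G_k(□)`: the duality remark, the
Riesz–Thorin step, the representation (2.40) and the bound (2.41) (journal page = PDF page + 570).  Quoted from the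
page renders `b2b-balaban-ref1/pages/1983-cmp89-regularity-decay/1983-cmp89-regularity-decay-p007-x2.png`,
`…-p008-x2.png`, `…-p012-x2.png`, `…-p013-x2.png` (not from the OCR text); the print's `≦` is written `≤`.

## WHAT IS PRINTED (verbatim from the renders)

pp. 577–578, Lemma 2.2: «Let a rectangular parallelepiped □ be a sum of few large blocks (e.g., as in the case of
the cubes □_j), and let Ã be a regular vector field configuration in the sense of Proposition I.2.1, constant in a
neighbourhood of the boundary of □. Then for e sufficiently small and α < 1, there exists a constant c₁ depending on
d, α only, such that ‖G_k(□,Ã)f‖_{1,α} ≤ c₁‖f‖_∞, (2.16) and a constant c₂ depending on d, p₁, such that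
‖G_k(□,Ã)f‖_q, ‖D^η_{Ã,μ}G_k(□,Ã)f‖_q, ‖G_k(□,Ã)D^{η*}_{Ã,μ}f‖_q ≤ c₂‖f‖_p (2.17) for 1 ≤ p, q ≤ ∞, satisfying
the condition 1/p − 1/p₁ ≤ 1/q ≤ 1/p with p₁ > d.»

p. 583: «Now we will prove the inequality (2.17) for G_k(□). For q = p = ∞, it is a special case of (2.16), but
for lack of dependence on α, and was proved above. For q = p = 1 we get it by duality argument, i.e. using the fact
that the space L^∞(□) is adjoint to L¹(□). The Riesz-Thorin Theorem implies it for arbitrary q = p from [1, ∞].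
(For Riesz-Thorin Theorem see Ref. [6].)  Now we will prove that the operators G_k(□), ∂^η_μG_k(□), G_k(□)∂^{η*}_μ
are bounded operators from L^{p₁}(□) with p₁ > d to L^∞(□). We will use again the representation (2.34). Let us
consider for example the operator G_k(□)∂^{η*}_μ:
(G_k(□)∂^{η*}_μf)(x) = η(C^{(0)}(η^{−1}□)∂^{1*}_μf)(η^{−1}x)
 + Σ_{j=1}^{k−1} a_j²L^jη(G_j((L^jη)^{−1}□)Q_j^*C^{(j)}((L^jη)^{−1}□)Q_jG_j((L^jη)^{−1}□)∂^{L^{−j}*}_μf)((L^jη)^{−1}x). (2.40)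
Hence |(G_k(□)∂^{η*}_μf)(x)| ≤ η2c₀O(1)η^{−d/p₁}‖f‖_{p₁}
 + Σ_{j=1}^{k−1} O(1)L^jη Σ_{y∈(L^jη)^{−1}□^{(j)}} e^{−δ₀|(L^jη)^{−1}x−y|}|(Q_jG_j((L^jη)^{−1}□)∂^{L^{−j}*}_μf)(y)|
 ≤ O(1)η^{1−d/p₁}‖f‖_{p₁} + Σ_{j=1}^{k−1} O(1)(L^jη)^{1−d/p₁}‖f‖_{p₁} ≤ c′₂‖f‖_{p₁} (2.41)
for x ∈ □, p₁ > d, where the constant c′₂ is built of c₀, Σ_{x∈Z^d} e^{−δ₀|x|}, Σ_{j=1}^∞ (L^{−j})^{1−d/p₁}. Again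
by the duality argument we get that the operator G_k(□) and its first order derivatives are bounded operators from
L¹(□) to L^{p′₁}(□), p′₁^{−1} + p₁^{−1} = 1. The Riesz-Thorin Theorem gives us finally (2.17) for G_k(□) and for
all p, q described in the figure» ⟦the figure: the parallelogram with vertices (0,0), (p₁^{−1},0), (1,1),
(1,p′₁^{−1}) in the (p^{−1},q^{−1})-plane, legend «1/p − 1/p₁ ≤ 1/q ≤ 1/p, 1 ≤ p,q ≤ ∞»⟧ «Thus Lemma 2.2 is
proved, or rather reduced to Lemma 2.4.»

## WHAT IS CERTIFIED (HONEST SCOPE)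

THE CASE `Ã = 0` (so `D^η_{0,μ} = B4Cor23Zero.fdiff`, `D^{η*}_{0,μ} = B4Cor23Zero.fdiffT`) for the operator
`G_k(□,0) = (−Δ^{η,N}_□ + m² + aP_k)^{-1}` of (1.6) with the literal coefficient `a > 0` (b04's
`ZeroFieldCube.green a = (fineOpR n a m² R)⁻¹`), on RECTANGULAR PARALLELEPIPEDS `□ = Π_μ[0, M_μ)` (`M_μ ≥ 1` unit
blocks; fine points `boxDom (L^k·M)`, mesh `η = L^{-k}`, `L = ℓ + 1 ≥ 2`) of the `(d+1)`-dimensional lattice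
`Fin (d+1) → ℤ`, UNIFORMLY in the scale `k ≥ 1`, the box and the mass `m² ∈ [0, m²₊]`: the ZERO-FIELD BOX FAMILY
`BoxInst d ℓ m²₊` of node 12 (`B4Ineq19ZeroBoxEta`), read in b04's zero-field cube carrier through node 15's
`toZFC : BoxInst → B4Lemma21Zero.ZeroFieldCube` and `cubeFam ℓ m²₊ a Mb K i := zeroFieldCube a Mb K (toZFC i)`
(b04's and node 15's files are untouched).  The norms are b04's `ZeroFieldCube.lpN s` — the `η`-weighted norm
`‖f‖_p = (η^{d+1}Σ_x|f(x)|^p)^{1/p}` of (2.11) indexed by `s = 1/p ∈ (0,1]`, and the sup norm at `s = 0`.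

* (2.17) OFF THE DIAGONAL, ALL THREE VECTORS — `lemma22_17_zero_box`: for every `p₁ > d + 1` ONE `c₂ > 0`
  (depending on `d, L, a, m²₊, p₁`) such that for every member, every `Y ∈ {G_k(□,0), D^η_μG_k(□,0),
  G_k(□,0)D^{η*}_μ}` (b04's `ZeroFieldCube.opY`), every axis `μ`, every `f` and all `0 ≤ t ≤ s ≤ 1` with
  `s − 1/p₁ ≤ t` (`s = 1/p`, `t = 1/q`): `‖Yf‖_q ≤ c₂‖f‖_p`.  This is the print's full range «1 ≤ p, q ≤ ∞,
  1/p − 1/p₁ ≤ 1/q ≤ 1/p» — the parallelogram of the figure on p. 583 — with the print's «p₁ > d» read as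
  `p₁ > d + 1`, `d + 1` being the dimension of the lattice `Fin (d+1) → ℤ` of this package (the print's `d` IS the
  lattice dimension); in particular the `L^{p₁} → L^∞` bounds (2.41) (`t = 0`, `s ≤ 1/p₁`) and their duals
  `L¹ → L^{p′₁}` (`s = 1`, `t ≥ 1 − 1/p₁`) are the two slanted edges.
* THE TYPED STATEMENT — `lemma22Printed_cubeFam`: b04's `B4.Lemma22Printed fam d'` is the conjunction
  (2.16)-clause ∧ (2.17)-clause, the latter quantified over `p₁ > d'` (`lemma22Printed_iff`, node 15, `Iff.rfl`).
  This file DISCHARGES `Lemma22Printed (cubeFam ℓ m²₊ a Mb K) (d + 1)` — BOTH CONJUNCTS VERBATIM, the dimension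
  parameter `d' := d + 1` = the lattice dimension of the family — for every `ℓ ≥ 1`, `a > 0`, `m²₊`, `Mb`, `K`:
  conjunct 1 is node 15's `lemma22Printed16_cubeFam` ((2.16) for every `α < 1`), conjunct 2 is
  `lemma22_17_zero_box`, with `e₁ = 1` (any threshold: the charge is inert at zero field; AS TYPED conjunct 2 on this
  family says exactly its threshold-free form, `lemma22Printed17_cubeFam_iff_free`) and no typed antecedent used.
  This COMPLETES node 15's diagonal certificate (`Lemma22PrintedDiag`, `q = p`) to the typed lemma itself at
  `d' = d + 1`; for `d' ≤ d` (a range of `p₁` wider than the print's) nothing is claimed.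
* THE ROUTE (a recorded DIVERGENCE from the print, same conclusion).  The print bounds each term of the multiscale
  representation (2.34)/(2.40) from `L^{p₁}` to `L^∞` ((2.41): the `j`-th term gains `(L^jη)^{1−d/p₁}`, summable in
  `j` iff `p₁ > d`), dualises, and interpolates by Riesz–Thorin.  Here the SAME representation is used in the form
  of this lineage, `G_k(□) = 𝒢_1 + Σ_{1≤j<k}(𝒢_{j+1} − 𝒢_j)` (node 6's `Gfine`, `Gfine_succ_sub`, with the running
  coefficient `a/c_k` whose top value is the literal `a`: `Gfine_top_coeff`, node 6's `aSeq_div_cK`), each of the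
  three vectors being a kernel operator `Σ_x T(x′,x)f(x)` (`kerOf`; node 15's `kerY`, `opY_apply`: `T₀ = G`,
  `T₁(x′,x) = L^k(G(fwd_μx′,x) − G(x′,x))`, `T₂(x′,x) = L^k(G(x′,fwd_μx) − G(x′,x))`, additive in `G`:
  `kerOf_add`).  For EACH PIECE the three kernels satisfy a SCALED PACKAGE `PB` (§§5–6, `pieces_PB`): with
  `γ = L^{k−j}` (`= (L^jη)^{-1}`; `γ = L^{k−1}` for the start piece `𝒢_1`) and ONE constant `Γ` (depending on
  `d, L`, the coefficient window and `m²₊`): entries `|T(x′,x)| ≤ Γγ^dη^{d+1}`, row sums AND column sums `≤ Γ/γ` —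
  the entries from the exponential decay of the pieces at their own scale (node 6's `boxOpR_L_inv_decay` for `𝒢_1`,
  node 6's (2.35)–(2.37)-type factor bounds `step_term_bound` / node 7's `step_termD_bound` / node 8's
  `step_termDcol_bound` at weight rate `0` for `𝒢_{j+1} − 𝒢_j`, `fluct_entry`, `fluctD_entry`), the row sums
  likewise (`start_PB0`, `start_PB1`, `fluct_row`, `fluctD_row`), the column sums by symmetry (`T₀ᵀ = T₀`,
  `T₁ᵀ = T₂`: `PB_kerOf`, `fluct_isSymm`, node 6's `Gfine_isSymm`; `fluct_col`, `fluctD_col`) — «by duality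
  argument».  Then, in place of «Riesz-Thorin», the elementary KERNEL YOUNG INEQUALITY on a finite set (§2,
  `young_count`: `|T| ≤ P`, row and column sums `≤ W` give `‖T‖_{p→q} ≤ P^{1/p−1/q}W^{1−(1/p−1/q)}` in counting
  measure for `1 ≤ p ≤ q ≤ ∞`, `1/p − 1/q < 1`, proved from the three-factor Hölder inequality `holder3`, itself
  from Mathlib's weighted AM–GM inequality `Real.geom_mean_le_arith_mean3_weighted`),
  transported to the `η`-weighted norms (`lpN_young`, `lpN_young_scaled`): the piece at scale `γ` maps
  `L^p → L^q` with norm `≤ Γγ^{(d+1)(1/p−1/q)−1} ≤ Γγ^{(d+1)/p₁−1}` — the print's factor `(L^jη)^{1−d/p₁}` with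
  `d ↦ d+1` — and the pieces are summed by MINKOWSKI (`lpN_add_le`) along `j` (`Gfine_lpN_bound`, `geom_step`:
  `Σ_{i≤k−j}ρ^i ≤ 1/(1−ρ)`, `ρ = L^{(d+1)/p₁−1} < 1` iff `p₁ > d+1` — the print's «Σ_{j=1}^∞ (L^{−j})^{1−d/p₁}»).
  No interpolation theorem, no complex analysis; the convergence mechanism (`p₁ >` dimension) is the print's.
* NON-VACUITY AS KERNEL FACTS (node 15's `threshold_metC`): for every threshold `e₁ > 0`, `Mb ≥ 1`, `K ≥ 1` and
  EVERY scale `k ≥ 1` some member meets ALL SIX typed antecedents, so the uniformity in `k` certified here is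
  exercised by the typed statement; the statements are instantiated at `d + 1 = 4`, `L = 2`, `p₁ = 5`, `(p,q) =
  (1, 5/4)` (closing examples).

NOT certified: any `Ã ≠ 0` — the content of Lemma 2.2 proper (the expansion (2.31)–(2.33), regularity of `Ã`,
«constant in a neighbourhood of the boundary of □», «for e sufficiently small»; at zero field these antecedents are
carried by the carrier as `True` / an inert charge and are not used); regions other than boxes (`G_k(Ω)`,
Proposition 2.1); the typed statement at a dimension parameter `d' ≤ d`; Lemma 2.4 itself (only its zero-field box
consequences enter, through nodes 6–8).  The constants depend on the family parameters `L, a, m²₊` (the print: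
«depending on d, p₁»), as in every node of this lineage.  No Literature fact is minted and no hypothesis is assumed:
every ingredient is a kernel-proved theorem of the modules imported.

DEPENDENCIES: node 15 `B4Lemma22ZeroBoxCube` (`toZFC`, `cubeFam`, `kerY`, `opY_apply`, `lemma22Printed_iff`,
`lemma22Printed16_cubeFam`, `rectC`, `threshold_metC`; → nodes 14, 12, 10, 8, 7, 6 and b04's `B4Lemma21Zero`:
`ZeroFieldCube`, `lpN`, `supN`, `opY`), node 8 `B4Lemma22ZeroBoxDerivDual` (`fwd`, `fwd_spec`,
`supNorm_sub_le_sub_fwd`, `step_termDcol_bound`), node 7 `B4Thm110ZeroBoxDeriv` (`wsum`, `sum_abs_le_wsum`,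
`mul3_row_sub`, `Gfine_blockRowDiff_bound`, `step_termD_bound`), node 6 `B4Thm110ZeroBox` (the scales `Nf`, `Mj`,
`bj`, `sc`, the operators `Gfine`, `fineOp_top`, `Amat`/`Bmat`/`Cmat`, `Gfine_succ_sub`, `Gfine_isSymm`,
`Gfine_blockRow_bound`, `roww`, `boxOpR_L_inv_decay`, `step_term_bound`, `aSeq_window`, the coefficient tools `cK`,
`aSeq_div_cK`, `Linv_sq_bounds`), `B4BoxCov237` (`boxOpR`, `boxOpR_inv_isSymm`, `rho_sumBound`,
`cov237_box_decay`), `B4Sect5Proof.latticeConst`, `B4ContourShift.supNorm`, `B4Reflection242` (`boxDom`, `blk`),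
b04's `B4` (`CubeSetting`, `Lemma22Printed`); Mathlib (`Real.rpow`, `Real.geom_mean_le_arith_mean3_weighted`,
`Real.Lp_add_le`).

Value = kernel certificate of a published lemma (B4 Lemma 2.2, (2.17) in its full `(p,q)`-range) in a special case
(`Ã = 0`, boxes) and of the cell's typed form `B4.Lemma22Printed` on the zero-field box family; NOT summit progress.
-/

namespace Literature.MathematicalPhysics.QuantumFieldTheory.Balaban1983to89.B4Lemma22ZeroBoxLpLq

open Finset Matrix
open Literature.MathematicalPhysics.QuantumFieldTheory.Balaban1983to89.B4 (CubeSetting Lemma22Printed)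
open Literature.MathematicalPhysics.QuantumFieldTheory.Balaban1983to89.B4ContourShift (supNorm supNorm_nonneg)
open Literature.MathematicalPhysics.QuantumFieldTheory.Balaban1983to89.B4Reflection242 (boxDom blk)
open Literature.MathematicalPhysics.QuantumFieldTheory.Balaban1983to89.B4BoxCov237 (boxOpR boxOpR_inv_isSymm rho
  rho_sumBound cov237_box_decay)
open Literature.MathematicalPhysics.QuantumFieldTheory.Balaban1983to89.B4Sect5Proof (latticeConst latticeConst_nonneg)
open Literature.MathematicalPhysics.QuantumFieldTheory.Balaban1983to89.B4Thm110ZeroBox (Nf Mj Mp bj sc sc_pos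
  one_le_sc bj_pos bj_cast sc_mul_bj sc_self one_lt_L_real L_real_pos Gfine Gfine_apply Gfine_isSymm
  Gfine_blockRow_bound Gfine_succ_sub fineOp_top αj Amat Bmat Cmat aSeq_window aminus'_pos roww rowSum_le_roww
  boxOpR_L_inv_decay step_term_bound blk_bj_mem Mp_pos ej cK cK_pos cK_le_one
  oneSub_le_cK aSeq_div_cK Linv_sq_bounds)
open Literature.MathematicalPhysics.QuantumFieldTheory.Balaban1983to89.B4Thm110ZeroBoxDeriv (wsum sum_abs_le_wsum
  mul3_row_sub Gfine_blockRowDiff_bound step_termD_bound)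
open Literature.MathematicalPhysics.QuantumFieldTheory.Balaban1983to89.B4Lemma22ZeroBoxDerivDual (fwd fwd_spec
  supNorm_sub_le_sub_fwd step_termDcol_bound)
open Literature.MathematicalPhysics.QuantumFieldTheory.Balaban1983to89.B4Ineq19ZeroBoxEta (BoxInst)
open Literature.MathematicalPhysics.QuantumFieldTheory.Balaban1983to89.B4Lemma21Zero (ZeroFieldCube zeroFieldCube)
open Literature.MathematicalPhysics.QuantumFieldTheory.Balaban1983to89.B4Lemma22ZeroBoxCube (toZFC cubeFam
  green_eq_box kerY opY_apply supN_le_of_forall abs_sum_mul_le lemma22Printed_iff lemma22Printed16_cubeFam rectC)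

noncomputable section

variable {d : ℕ}

/-! ## §1 Three-factor Hölder on a finite set (from the weighted AM–GM inequality) -/

section Holder

variable {ι : Type*} [Fintype ι]

/-- `Σ_i g_i / (Σ_j g_j) ≤ 1` for `g ≥ 0` (the quotient is `0` when the sum vanishes). [folklore] -/
theorem sum_div_self_le_one (g : ι → ℝ) (hg : ∀ i, 0 ≤ g i) : ∑ i, g i / (∑ j, g j) ≤ 1 := by
  rw [← Finset.sum_div]
  rcases eq_or_lt_of_le (Finset.sum_nonneg fun i (_ : i ∈ (univ : Finset ι)) => hg i) with h | h
  · rw [← h, div_zero]; exact zero_le_one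
  · rw [div_self h.ne']

/-- **THREE-FACTOR HÖLDER INEQUALITY with weights `θ₁ + θ₂ + θ₃ = 1`** on a finite set:
`Σ_i u_i^{θ₁} v_i^{θ₂} w_i^{θ₃} ≤ (Σu)^{θ₁} (Σv)^{θ₂} (Σw)^{θ₃}` for `u, v, w ≥ 0`, `θ_m ≥ 0` — by the weighted
AM–GM inequality (`Real.geom_mean_le_arith_mean3_weighted`) applied to the normalised terms; the degenerate sums
are covered by the conventions `x/0 = 0`, `0^θ = 0` (`θ ≠ 0`), `0^0 = 1`. [folklore] -/
theorem holder3 (u v w : ι → ℝ) (hu : ∀ i, 0 ≤ u i) (hv : ∀ i, 0 ≤ v i) (hw : ∀ i, 0 ≤ w i)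
    {θ₁ θ₂ θ₃ : ℝ} (h1 : 0 ≤ θ₁) (h2 : 0 ≤ θ₂) (h3 : 0 ≤ θ₃) (hθ : θ₁ + θ₂ + θ₃ = 1) :
    ∑ i, u i ^ θ₁ * v i ^ θ₂ * w i ^ θ₃ ≤ (∑ i, u i) ^ θ₁ * (∑ i, v i) ^ θ₂ * (∑ i, w i) ^ θ₃ := by
  set U := ∑ i, u i with hUdef
  set V := ∑ i, v i with hVdef
  set W := ∑ i, w i with hWdef
  have hU : 0 ≤ U := Finset.sum_nonneg fun i _ => hu i
  have hV : 0 ≤ V := Finset.sum_nonneg fun i _ => hv i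
  have hW : 0 ≤ W := Finset.sum_nonneg fun i _ => hw i
  have key : ∑ i, (u i / U) ^ θ₁ * (v i / V) ^ θ₂ * (w i / W) ^ θ₃ ≤ 1 := by
    have e1 := sum_div_self_le_one u hu
    have e2 := sum_div_self_le_one v hv
    have e3 := sum_div_self_le_one w hw
    calc ∑ i, (u i / U) ^ θ₁ * (v i / V) ^ θ₂ * (w i / W) ^ θ₃
        ≤ ∑ i, (θ₁ * (u i / U) + θ₂ * (v i / V) + θ₃ * (w i / W)) :=
          Finset.sum_le_sum fun i _ => Real.geom_mean_le_arith_mean3_weighted h1 h2 h3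
            (div_nonneg (hu i) hU) (div_nonneg (hv i) hV) (div_nonneg (hw i) hW) hθ
      _ = θ₁ * ∑ i, u i / U + θ₂ * ∑ i, v i / V + θ₃ * ∑ i, w i / W := by
          rw [Finset.sum_add_distrib, Finset.sum_add_distrib, Finset.mul_sum, Finset.mul_sum, Finset.mul_sum]
      _ ≤ θ₁ * 1 + θ₂ * 1 + θ₃ * 1 :=
          add_le_add (add_le_add (mul_le_mul_of_nonneg_left e1 h1) (mul_le_mul_of_nonneg_left e2 h2))
            (mul_le_mul_of_nonneg_left e3 h3)
      _ = 1 := by linarith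
  have hterm : ∀ i, (u i / U) ^ θ₁ * (v i / V) ^ θ₂ * (w i / W) ^ θ₃
      = (u i ^ θ₁ * v i ^ θ₂ * w i ^ θ₃) / (U ^ θ₁ * V ^ θ₂ * W ^ θ₃) := by
    intro i
    rw [Real.div_rpow (hu i) hU, Real.div_rpow (hv i) hV, Real.div_rpow (hw i) hW]
    ring
  simp_rw [hterm] at key
  rw [← Finset.sum_div] at key
  have hD : 0 ≤ U ^ θ₁ * V ^ θ₂ * W ^ θ₃ := by positivity
  rcases eq_or_lt_of_le hD with hD0 | hDpos
  · rw [← hD0]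
    have hz : U ^ θ₁ = 0 ∨ V ^ θ₂ = 0 ∨ W ^ θ₃ = 0 := by
      rcases mul_eq_zero.1 hD0.symm with h | h
      · rcases mul_eq_zero.1 h with h' | h'
        · exact Or.inl h'
        · exact Or.inr (Or.inl h')
      · exact Or.inr (Or.inr h)
    apply le_of_eq
    apply Finset.sum_eq_zero
    intro i _
    rcases hz with h | h | h
    · obtain ⟨h0, hne⟩ := (Real.rpow_eq_zero_iff_of_nonneg hU).1 h
      have hi : u i = 0 := (Finset.sum_eq_zero_iff_of_nonneg (fun j _ => hu j)).1 h0 i (mem_univ _)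
      rw [hi, Real.zero_rpow hne]; ring
    · obtain ⟨h0, hne⟩ := (Real.rpow_eq_zero_iff_of_nonneg hV).1 h
      have hi : v i = 0 := (Finset.sum_eq_zero_iff_of_nonneg (fun j _ => hv j)).1 h0 i (mem_univ _)
      rw [hi, Real.zero_rpow hne]; ring
    · obtain ⟨h0, hne⟩ := (Real.rpow_eq_zero_iff_of_nonneg hW).1 h
      have hi : w i = 0 := (Finset.sum_eq_zero_iff_of_nonneg (fun j _ => hw j)).1 h0 i (mem_univ _)
      rw [hi, Real.zero_rpow hne]; ring
  · exact (div_le_one hDpos).1 key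

/-- the two-factor case `θ₁ + θ₂ = 1`: `Σ_i u_i^{θ₁} v_i^{θ₂} ≤ (Σu)^{θ₁}(Σv)^{θ₂}`. [folklore] -/
theorem holder2 (u v : ι → ℝ) (hu : ∀ i, 0 ≤ u i) (hv : ∀ i, 0 ≤ v i)
    {θ₁ θ₂ : ℝ} (h1 : 0 ≤ θ₁) (h2 : 0 ≤ θ₂) (hθ : θ₁ + θ₂ = 1) :
    ∑ i, u i ^ θ₁ * v i ^ θ₂ ≤ (∑ i, u i) ^ θ₁ * (∑ i, v i) ^ θ₂ := by
  have h := holder3 u v (fun _ => (1 : ℝ)) hu hv (fun _ => zero_le_one) h1 h2 le_rfl (by rw [add_zero, hθ])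
  simpa [Real.rpow_zero] using h

end Holder

/-! ## §2 An elementary kernel Young inequality on finite sets (counting measure) -/

section Young

variable {X Y : Type*} [Fintype X] [Fintype Y]

/-- `(a^{1/ρ})^{e₁}·(a^{1/ρ})^{e₂} = a` when `e₁ + e₂ = ρ ≠ 0`, `a ≥ 0`. [folklore] -/
theorem rpow_split {a ρ e₁ e₂ : ℝ} (ha : 0 ≤ a) (hρ : ρ ≠ 0) (he : e₁ + e₂ = ρ) :
    (a ^ (1 / ρ)) ^ e₁ * (a ^ (1 / ρ)) ^ e₂ = a := by
  rw [← Real.rpow_add' (Real.rpow_nonneg ha _) (by rw [he]; exact hρ), he, ← Real.rpow_mul ha,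
    one_div_mul_cancel hρ, Real.rpow_one]

/-- `a^{e+1} ≤ P^e·a` for `0 ≤ a ≤ P`, `e ≥ 0`. [folklore] -/
theorem rpow_succ_le {a P e : ℝ} (ha : 0 ≤ a) (haP : a ≤ P) (he : 0 ≤ e) : a ^ (e + 1) ≤ P ^ e * a := by
  rw [Real.rpow_add' ha (by linarith), Real.rpow_one]
  exact mul_le_mul_of_nonneg_right (Real.rpow_le_rpow ha haP he) ha

/-- `(A^t)^{1/t} = A` (`A ≥ 0`, `t ≠ 0`). [folklore] -/
theorem rpow_rpow_inv' {A t : ℝ} (hA : 0 ≤ A) (ht : t ≠ 0) : (A ^ t) ^ (1 / t) = A := by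
  rw [← Real.rpow_mul hA, mul_one_div_cancel ht, Real.rpow_one]

/-- `(A^{1/t})^{t} = A` (`A ≥ 0`, `t ≠ 0`). [folklore] -/
theorem rpow_inv_rpow' {A t : ℝ} (hA : 0 ≤ A) (ht : t ≠ 0) : (A ^ (1 / t)) ^ t = A := by
  rw [← Real.rpow_mul hA, one_div_mul_cancel ht, Real.rpow_one]

omit [Fintype X] in
/-- **THE ROW ESTIMATE**: for a kernel with `|T(x,y)| ≤ P` and row sums `Σ_y|T(x,y)| ≤ W`, exponents
`0 ≤ t ≤ s`, `0 < s ≤ 1`, `ρ := 1 − s + t > 0`: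
`Σ_y |T(x,y)||f(y)| ≤ (Σ_y |T(x,y)|^{1/ρ}|f(y)|^{1/s})^t · (P^{1/ρ−1}W)^{1−s} · (Σ_y|f(y)|^{1/s})^{s−t}` —
three-factor Hölder with weights `(t, 1−s, s−t)`. [folklore] -/
theorem row_estimate (T : X → Y → ℝ) (f : Y → ℝ) {P W s t : ℝ} (hP0 : 0 ≤ P) (hP : ∀ x y, |T x y| ≤ P)
    (hrow : ∀ x, ∑ y, |T x y| ≤ W) (ht0 : 0 ≤ t) (hts : t ≤ s) (hs0 : 0 < s) (hs1 : s ≤ 1) (hst : s - t < 1)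
    (x : X) :
    ∑ y, |T x y| * |f y|
      ≤ (∑ y, |T x y| ^ (1 / (1 - s + t)) * |f y| ^ (1 / s)) ^ t
          * (P ^ (1 / (1 - s + t) - 1) * W) ^ (1 - s) * (∑ y, |f y| ^ (1 / s)) ^ (s - t) := by
  set ρ : ℝ := 1 - s + t with hρdef
  have hρ0 : 0 < ρ := by rw [hρdef]; linarith
  have hρ1 : ρ ≤ 1 := by rw [hρdef]; linarith
  have hu : ∀ y, 0 ≤ |T x y| ^ (1 / ρ) * |f y| ^ (1 / s) := fun y =>
    mul_nonneg (Real.rpow_nonneg (abs_nonneg _) _) (Real.rpow_nonneg (abs_nonneg _) _)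
  have hv : ∀ y, 0 ≤ |T x y| ^ (1 / ρ) := fun y => Real.rpow_nonneg (abs_nonneg _) _
  have hw : ∀ y, 0 ≤ |f y| ^ (1 / s) := fun y => Real.rpow_nonneg (abs_nonneg _) _
  have hH := holder3 (fun y => |T x y| ^ (1 / ρ) * |f y| ^ (1 / s)) (fun y => |T x y| ^ (1 / ρ))
    (fun y => |f y| ^ (1 / s)) hu hv hw ht0 (by linarith : (0 : ℝ) ≤ 1 - s) (by linarith : (0 : ℝ) ≤ s - t)
    (by ring)
  have hterm : ∀ y, (|T x y| ^ (1 / ρ) * |f y| ^ (1 / s)) ^ t * (|T x y| ^ (1 / ρ)) ^ (1 - s)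
      * (|f y| ^ (1 / s)) ^ (s - t) = |T x y| * |f y| := by
    intro y
    rw [Real.mul_rpow (hv y) (hw y)]
    have e1 := rpow_split (abs_nonneg (T x y)) hρ0.ne' (show t + (1 - s) = ρ by rw [hρdef]; ring)
    have e2 := rpow_split (abs_nonneg (f y)) hs0.ne' (show t + (s - t) = s by ring)
    calc (|T x y| ^ (1 / ρ)) ^ t * (|f y| ^ (1 / s)) ^ t * (|T x y| ^ (1 / ρ)) ^ (1 - s)
          * (|f y| ^ (1 / s)) ^ (s - t)
        = ((|T x y| ^ (1 / ρ)) ^ t * (|T x y| ^ (1 / ρ)) ^ (1 - s))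
            * ((|f y| ^ (1 / s)) ^ t * (|f y| ^ (1 / s)) ^ (s - t)) := by ring
      _ = |T x y| * |f y| := by rw [e1, e2]
  simp only [hterm] at hH
  have hB : ∑ y, |T x y| ^ (1 / ρ) ≤ P ^ (1 / ρ - 1) * W := by
    have h1 : ∀ y, |T x y| ^ (1 / ρ) ≤ P ^ (1 / ρ - 1) * |T x y| := by
      intro y
      have h := rpow_succ_le (abs_nonneg (T x y)) (hP x y) (sub_nonneg.2 (one_le_one_div hρ0 hρ1))
      rwa [sub_add_cancel] at h
    calc ∑ y, |T x y| ^ (1 / ρ) ≤ ∑ y, P ^ (1 / ρ - 1) * |T x y| := Finset.sum_le_sum fun y _ => h1 y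
      _ = P ^ (1 / ρ - 1) * ∑ y, |T x y| := by rw [Finset.mul_sum]
      _ ≤ P ^ (1 / ρ - 1) * W := mul_le_mul_of_nonneg_left (hrow x) (Real.rpow_nonneg hP0 _)
  refine hH.trans ?_
  exact mul_le_mul_of_nonneg_right (mul_le_mul_of_nonneg_left
    (Real.rpow_le_rpow (Finset.sum_nonneg fun y _ => hv y) hB (by linarith)) (Real.rpow_nonneg
      (Finset.sum_nonneg fun y _ => hu y) _)) (Real.rpow_nonneg (Finset.sum_nonneg fun y _ => hw y) _)

/-- **KERNEL YOUNG INEQUALITY, counting measure, `0 < t`**: `|T| ≤ P`, row and column sums of `|T|` at most `W`,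
`0 < t ≤ s ≤ 1`, `s − t < 1` (`1 ≤ p = 1/s ≤ q = 1/t`, `1/p − 1/q < 1`):
`(Σ_x |Σ_y T(x,y)f(y)|^{1/t})^t ≤ P^{s−t}·W^{1−(s−t)}·(Σ_y |f(y)|^{1/s})^s`. [folklore] -/
theorem young_count (T : X → Y → ℝ) (f : Y → ℝ) {P W s t : ℝ} (hP0 : 0 ≤ P) (hW0 : 0 ≤ W)
    (hP : ∀ x y, |T x y| ≤ P) (hrow : ∀ x, ∑ y, |T x y| ≤ W) (hcol : ∀ y, ∑ x, |T x y| ≤ W)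
    (ht0 : 0 < t) (hts : t ≤ s) (hs1 : s ≤ 1) (hst : s - t < 1) :
    (∑ x, |∑ y, T x y * f y| ^ (1 / t)) ^ t
      ≤ P ^ (s - t) * W ^ (1 - (s - t)) * (∑ y, |f y| ^ (1 / s)) ^ s := by
  have hs0 : 0 < s := lt_of_lt_of_le ht0 hts
  set ρ : ℝ := 1 - s + t with hρdef
  have hρ0 : 0 < ρ := by rw [hρdef]; linarith
  have hρ1 : ρ ≤ 1 := by rw [hρdef]; linarith
  set Wr : ℝ := P ^ (1 / ρ - 1) * W with hWrdef
  have hWr : 0 ≤ Wr := mul_nonneg (Real.rpow_nonneg hP0 _) hW0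
  set F : ℝ := ∑ y, |f y| ^ (1 / s) with hFdef
  have hF : 0 ≤ F := Finset.sum_nonneg fun y _ => Real.rpow_nonneg (abs_nonneg _) _
  set A : X → ℝ := fun x => ∑ y, |T x y| ^ (1 / ρ) * |f y| ^ (1 / s) with hAdef
  have hA : ∀ x, 0 ≤ A x := fun x => Finset.sum_nonneg fun y _ =>
    mul_nonneg (Real.rpow_nonneg (abs_nonneg _) _) (Real.rpow_nonneg (abs_nonneg _) _)
  have hM : 0 ≤ Wr ^ (1 - s) * F ^ (s - t) := mul_nonneg (Real.rpow_nonneg hWr _) (Real.rpow_nonneg hF _)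
  -- pointwise in `x`
  have hpt : ∀ x, |∑ y, T x y * f y| ^ (1 / t) ≤ A x * (Wr ^ (1 - s) * F ^ (s - t)) ^ (1 / t) := by
    intro x
    have h1 : |∑ y, T x y * f y| ≤ ∑ y, |T x y| * |f y| :=
      (Finset.abs_sum_le_sum_abs _ _).trans (le_of_eq (Finset.sum_congr rfl fun y _ => abs_mul _ _))
    have h2 := row_estimate T f hP0 hP hrow ht0.le hts hs0 hs1 hst x
    calc |∑ y, T x y * f y| ^ (1 / t) ≤ ((A x) ^ t * Wr ^ (1 - s) * F ^ (s - t)) ^ (1 / t) :=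
          Real.rpow_le_rpow (abs_nonneg _) (h1.trans h2) (by positivity)
      _ = A x * (Wr ^ (1 - s) * F ^ (s - t)) ^ (1 / t) := by
          rw [mul_assoc, Real.mul_rpow (Real.rpow_nonneg (hA x) _) hM, rpow_rpow_inv' (hA x) ht0.ne']
  -- the column bound: `Σ_x A(x) ≤ Wr·F`
  have hsumA : ∑ x, A x ≤ Wr * F := by
    have hcolr : ∀ y, ∑ x, |T x y| ^ (1 / ρ) ≤ Wr := by
      intro y
      have h1 : ∀ x, |T x y| ^ (1 / ρ) ≤ P ^ (1 / ρ - 1) * |T x y| := by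
        intro x
        have h := rpow_succ_le (abs_nonneg (T x y)) (hP x y) (sub_nonneg.2 (one_le_one_div hρ0 hρ1))
        rwa [sub_add_cancel] at h
      calc ∑ x, |T x y| ^ (1 / ρ) ≤ ∑ x, P ^ (1 / ρ - 1) * |T x y| := Finset.sum_le_sum fun x _ => h1 x
        _ = P ^ (1 / ρ - 1) * ∑ x, |T x y| := by rw [Finset.mul_sum]
        _ ≤ Wr := mul_le_mul_of_nonneg_left (hcol y) (Real.rpow_nonneg hP0 _)
    calc ∑ x, A x = ∑ y, (∑ x, |T x y| ^ (1 / ρ)) * |f y| ^ (1 / s) := by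
          simp only [hAdef, Finset.sum_mul]
          rw [Finset.sum_comm]
      _ ≤ ∑ y, Wr * |f y| ^ (1 / s) :=
          Finset.sum_le_sum fun y _ => mul_le_mul_of_nonneg_right (hcolr y) (Real.rpow_nonneg (abs_nonneg _) _)
      _ = Wr * F := by rw [← Finset.mul_sum]
  have hsum : ∑ x, |∑ y, T x y * f y| ^ (1 / t) ≤ Wr * F * (Wr ^ (1 - s) * F ^ (s - t)) ^ (1 / t) := by
    calc ∑ x, |∑ y, T x y * f y| ^ (1 / t) ≤ ∑ x, A x * (Wr ^ (1 - s) * F ^ (s - t)) ^ (1 / t) :=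
          Finset.sum_le_sum fun x _ => hpt x
      _ = (∑ x, A x) * (Wr ^ (1 - s) * F ^ (s - t)) ^ (1 / t) := by rw [Finset.sum_mul]
      _ ≤ Wr * F * (Wr ^ (1 - s) * F ^ (s - t)) ^ (1 / t) :=
          mul_le_mul_of_nonneg_right hsumA (Real.rpow_nonneg hM _)
  have hfin : (Wr * F * (Wr ^ (1 - s) * F ^ (s - t)) ^ (1 / t)) ^ t = Wr ^ ρ * F ^ s := by
    rw [Real.mul_rpow (mul_nonneg hWr hF) (Real.rpow_nonneg hM _), rpow_inv_rpow' hM ht0.ne',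
      Real.mul_rpow hWr hF,
      show Wr ^ t * F ^ t * (Wr ^ (1 - s) * F ^ (s - t)) = (Wr ^ t * Wr ^ (1 - s)) * (F ^ t * F ^ (s - t))
        by ring,
      ← Real.rpow_add' hWr (show t + (1 - s) ≠ 0 by rw [show t + (1 - s) = ρ by rw [hρdef]; ring]; exact hρ0.ne'),
      ← Real.rpow_add' hF (show t + (s - t) ≠ 0 by rw [show t + (s - t) = s by ring]; exact hs0.ne'),
      show t + (1 - s) = ρ by rw [hρdef]; ring, show t + (s - t) = s by ring]
  have hWrρ : Wr ^ ρ = P ^ (s - t) * W ^ (1 - (s - t)) := by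
    rw [hWrdef, Real.mul_rpow (Real.rpow_nonneg hP0 _) hW0, ← Real.rpow_mul hP0,
      show (1 / ρ - 1) * ρ = s - t by field_simp; rw [hρdef]; ring, show ρ = 1 - (s - t) by rw [hρdef]; ring]
  calc (∑ x, |∑ y, T x y * f y| ^ (1 / t)) ^ t ≤ (Wr * F * (Wr ^ (1 - s) * F ^ (s - t)) ^ (1 / t)) ^ t :=
        Real.rpow_le_rpow (Finset.sum_nonneg fun x _ => Real.rpow_nonneg (abs_nonneg _) _) hsum ht0.le
    _ = Wr ^ ρ * F ^ s := hfin
    _ = P ^ (s - t) * W ^ (1 - (s - t)) * F ^ s := by rw [hWrρ]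

omit [Fintype X] in
/-- **the endpoint `t = 0` (`q = ∞`)**: `|Σ_y T(x,y)f(y)| ≤ P^s·W^{1−s}·(Σ_y|f(y)|^{1/s})^s` for `0 < s < 1`.
[folklore] -/
theorem young_count_sup (T : X → Y → ℝ) (f : Y → ℝ) {P W s : ℝ} (hP0 : 0 ≤ P) (hW0 : 0 ≤ W)
    (hP : ∀ x y, |T x y| ≤ P) (hrow : ∀ x, ∑ y, |T x y| ≤ W) (hs0 : 0 < s) (hs1 : s < 1) (x : X) :
    |∑ y, T x y * f y| ≤ P ^ s * W ^ (1 - s) * (∑ y, |f y| ^ (1 / s)) ^ s := by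
  have h1 : |∑ y, T x y * f y| ≤ ∑ y, |T x y| * |f y| :=
    (Finset.abs_sum_le_sum_abs _ _).trans (le_of_eq (Finset.sum_congr rfl fun y _ => abs_mul _ _))
  have h2 := row_estimate T f hP0 hP hrow le_rfl hs0.le hs0 hs1.le (by linarith) x
  rw [Real.rpow_zero, one_mul, sub_zero, add_zero] at h2
  refine h1.trans (h2.trans (le_of_eq ?_))
  have hρ0 : 0 < 1 - s := by linarith
  rw [Real.mul_rpow (Real.rpow_nonneg hP0 _) hW0, ← Real.rpow_mul hP0,
    show (1 / (1 - s) - 1) * (1 - s) = s by field_simp; ring]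

end Young

/-! ## §3 The kernel Young inequality for b04's weighted norms `lpN` (`‖f‖_p = (η^{d+1}Σ|f|^p)^{1/p}`, `p = 1/s`) -/

section Weighted

variable (i : ZeroFieldCube d)

/-- `0 ≤ ‖f‖_∞` for b04's cube carrier `ZeroFieldCube` (node 12's `supN_nonneg` is the same fact for b04's other
carrier `ZeroFieldInstance`). [folklore] -/
theorem supN_nonneg_cube (i : ZeroFieldCube d) (f : ↥i.R → ℝ) : 0 ≤ ZeroFieldCube.supN i f := by
  unfold ZeroFieldCube.supN
  split_ifs with h
  · obtain ⟨x, hx⟩ := h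
    exact (abs_nonneg (f x)).trans (Finset.le_sup' (fun y => |f y|) hx)
  · exact le_rfl

/-- `|f x| ≤ ‖f‖_∞` for b04's cube carrier `ZeroFieldCube` (node 12's `abs_le_supN`: the same for
`ZeroFieldInstance`). [folklore] -/
theorem abs_le_supN_cube (i : ZeroFieldCube d) (f : ↥i.R → ℝ) (x : ↥i.R) : |f x| ≤ ZeroFieldCube.supN i f := by
  unfold ZeroFieldCube.supN
  rw [dif_pos ⟨x, Finset.mem_univ _⟩]
  exact Finset.le_sup' (fun y => |f y|) (Finset.mem_univ x)

/-- `0 ≤ ‖f‖_p`. [folklore] -/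
theorem lpN_nonneg (s : ℝ) (f : ↥i.R → ℝ) : 0 ≤ i.lpN s f := by
  unfold ZeroFieldCube.lpN
  split_ifs
  · exact supN_nonneg_cube i f
  · exact Real.rpow_nonneg (mul_nonneg (by positivity)
      (Finset.sum_nonneg fun x _ => Real.rpow_nonneg (abs_nonneg _) _)) _

/-- the lattice weight: `(Σ_x |f x|^{1/s})^s = (n^{d+1})^s·‖f‖_{1/s}` for `0 < s`. [folklore] -/
theorem sum_rpow_eq_lpN (f : ↥i.R → ℝ) {s : ℝ} (hs : 0 < s) :
    (∑ x, |f x| ^ (1 / s)) ^ s = ((i.n : ℝ) ^ (d + 1)) ^ s * i.lpN s f := by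
  have hn : (0 : ℝ) < i.n := by exact_mod_cast i.hn
  have hF : 0 ≤ ∑ x, |f x| ^ (1 / s) := Finset.sum_nonneg fun x _ => Real.rpow_nonneg (abs_nonneg _) _
  have hw : 0 ≤ ((1 : ℝ) / i.n) ^ (d + 1) := by positivity
  unfold ZeroFieldCube.lpN
  rw [if_neg hs.ne', Real.mul_rpow hw hF, ← mul_assoc, ← Real.mul_rpow (by positivity) hw,
    show (i.n : ℝ) ^ (d + 1) * ((1 : ℝ) / i.n) ^ (d + 1) = 1 by
      rw [one_div, inv_pow, mul_inv_cancel₀ (pow_ne_zero _ hn.ne')], Real.one_rpow, one_mul]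

/-- **KERNEL YOUNG INEQUALITY FOR b04's NORMS** (the off-diagonal interpolation tool of this file): for
`g = Σ_x T(·,x)f(x)` on the `η = 1/n` lattice cube with `|T| ≤ P`, row and column sums of `|T|` at most `W`, and
`0 ≤ t ≤ s ≤ 1`, `s − t < 1` (`q = 1/t ≥ p = 1/s ≥ 1`, `1/p − 1/q < 1`):
`‖g‖_q ≤ (n^{d+1}P)^{s−t}·W^{1−(s−t)}·‖f‖_p` — the factor `n^{d+1} = η^{−(d+1)}` is the price of the lattice
weights when `q > p`. [folklore] -/
theorem lpN_young (T : ↥i.R → ↥i.R → ℝ) (f g : ↥i.R → ℝ) (hg : ∀ x', g x' = ∑ x, T x' x * f x)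
    {P W : ℝ} (hP0 : 0 ≤ P) (hW0 : 0 ≤ W) (hP : ∀ x' x, |T x' x| ≤ P) (hrow : ∀ x', ∑ x, |T x' x| ≤ W)
    (hcol : ∀ x, ∑ x', |T x' x| ≤ W) {s t : ℝ} (ht0 : 0 ≤ t) (hts : t ≤ s) (hs1 : s ≤ 1) (hst : s - t < 1) :
    i.lpN t g ≤ ((i.n : ℝ) ^ (d + 1) * P) ^ (s - t) * W ^ (1 - (s - t)) * i.lpN s f := by
  have hn : (0 : ℝ) < i.n := by exact_mod_cast i.hn
  set N : ℝ := (i.n : ℝ) ^ (d + 1) with hNdef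
  have hN : 0 < N := by positivity
  have hgx : ∀ x', |g x'| = |∑ x, T x' x * f x| := fun x' => by rw [hg x']
  rcases ht0.eq_or_lt with ht | ht
  · -- `t = 0`: the sup norm of `g`
    subst ht
    have hs0 : 0 ≤ s := hts
    rcases hs0.eq_or_lt with hs | hs
    · -- `s = 0`
      subst hs
      rw [sub_self, Real.rpow_zero, one_mul, sub_zero, Real.rpow_one]
      unfold ZeroFieldCube.lpN
      rw [if_pos rfl, if_pos rfl]
      refine supN_le_of_forall i g (mul_nonneg hW0 (supN_nonneg_cube i f)) fun x' => ?_
      rw [hg x']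
      calc |∑ x, T x' x * f x| ≤ (∑ x, |T x' x|) * i.supN f := abs_sum_mul_le T f x' (abs_le_supN_cube i f)
        _ ≤ W * i.supN f := mul_le_mul_of_nonneg_right (hrow x') (supN_nonneg_cube i f)
    · -- `0 < s < 1`
      rw [sub_zero] at hst ⊢
      have h1 : ∀ x', |g x'| ≤ P ^ s * W ^ (1 - s) * (∑ x, |f x| ^ (1 / s)) ^ s := fun x' => by
        rw [hg x']
        exact young_count_sup T f hP0 hW0 hP hrow hs hst x'
      have hB : 0 ≤ P ^ s * W ^ (1 - s) * (∑ x, |f x| ^ (1 / s)) ^ s := by positivity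
      have h2 : i.lpN 0 g ≤ P ^ s * W ^ (1 - s) * (∑ x, |f x| ^ (1 / s)) ^ s := by
        unfold ZeroFieldCube.lpN
        rw [if_pos rfl]
        exact supN_le_of_forall i g hB h1
      refine h2.trans (le_of_eq ?_)
      rw [sum_rpow_eq_lpN i f hs, Real.mul_rpow hN.le hP0]
      ring
  · -- `0 < t ≤ s ≤ 1`
    have hs : 0 < s := lt_of_lt_of_le ht hts
    have hY := young_count T f hP0 hW0 hP hrow hcol ht hts hs1 hst
    simp only [← hgx] at hY
    rw [sum_rpow_eq_lpN i f hs, sum_rpow_eq_lpN i g ht] at hY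
    -- divide by `N^t`: `N^t·‖g‖_q ≤ P^σ W^{1−σ} N^s ‖f‖_p`
    have hNt : 0 < N ^ t := Real.rpow_pos_of_pos hN t
    have key : i.lpN t g ≤ (N ^ t)⁻¹ * (P ^ (s - t) * W ^ (1 - (s - t)) * (N ^ s * i.lpN s f)) := by
      rw [le_inv_mul_iff₀ hNt]
      exact hY
    refine key.trans (le_of_eq ?_)
    rw [Real.mul_rpow hN.le hP0, show N ^ (s - t) = (N ^ t)⁻¹ * N ^ s by
      rw [← Real.rpow_neg hN.le, ← Real.rpow_add hN]; congr 1; ring]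
    ring

/-- `(Γγ^d)^σ·(Γ/γ)^{1−σ} = Γ·γ^{(d+1)σ−1}` (`Γ ≥ 0`, `γ > 0`). [folklore] -/
theorem scaled_consts {Γ γ σ : ℝ} (hΓ : 0 ≤ Γ) (hγ : 0 < γ) (d : ℕ) :
    (Γ * γ ^ d) ^ σ * (Γ / γ) ^ (1 - σ) = Γ * γ ^ (((d : ℝ) + 1) * σ - 1) := by
  rw [Real.mul_rpow hΓ (pow_nonneg hγ.le _), Real.div_rpow hΓ hγ.le,
    show Γ ^ σ * (γ ^ d) ^ σ * (Γ ^ (1 - σ) / γ ^ (1 - σ))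
      = (Γ ^ σ * Γ ^ (1 - σ)) * ((γ ^ d) ^ σ * (γ ^ (1 - σ))⁻¹) by ring,
    ← Real.rpow_add' hΓ (by norm_num : σ + (1 - σ) ≠ 0), show σ + (1 - σ) = 1 by ring, Real.rpow_one,
    ← Real.rpow_natCast γ d, ← Real.rpow_mul hγ.le, ← Real.rpow_neg hγ.le, ← Real.rpow_add hγ]
  congr 1
  ring

/-- **SCALED FORM** (the shape every piece of the multiscale expansion has, §6): if `|T| ≤ Γγ^d/n^{d+1}`, row
and column sums `≤ Γ/γ` with `γ ≥ 1`, then for `0 ≤ t ≤ s ≤ 1`, `s − t < 1` and any `e ≥ (d+1)(s−t) − 1`: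
`‖Σ_x T(·,x)f(x)‖_q ≤ Γ·γ^e·‖f‖_p`. [folklore] -/
theorem lpN_young_scaled (T : ↥i.R → ↥i.R → ℝ) (f g : ↥i.R → ℝ) (hg : ∀ x', g x' = ∑ x, T x' x * f x)
    {Γ γ : ℝ} (hΓ : 0 ≤ Γ) (hγ : 1 ≤ γ) (hP : ∀ x' x, |T x' x| ≤ Γ * γ ^ d / (i.n : ℝ) ^ (d + 1))
    (hrow : ∀ x', ∑ x, |T x' x| ≤ Γ / γ) (hcol : ∀ x, ∑ x', |T x' x| ≤ Γ / γ)
    {s t e : ℝ} (ht0 : 0 ≤ t) (hts : t ≤ s) (hs1 : s ≤ 1) (hst : s - t < 1)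
    (he : ((d : ℝ) + 1) * (s - t) - 1 ≤ e) :
    i.lpN t g ≤ Γ * γ ^ e * i.lpN s f := by
  have hn : (0 : ℝ) < i.n := by exact_mod_cast i.hn
  have hN : (0 : ℝ) < (i.n : ℝ) ^ (d + 1) := by positivity
  have hγ0 : 0 < γ := lt_of_lt_of_le one_pos hγ
  have h := lpN_young i T f g hg (by positivity) (by positivity) hP hrow hcol ht0 hts hs1 hst
  rw [show (i.n : ℝ) ^ (d + 1) * (Γ * γ ^ d / (i.n : ℝ) ^ (d + 1)) = Γ * γ ^ d by field_simp,
    scaled_consts hΓ hγ0 d] at h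
  exact h.trans (mul_le_mul_of_nonneg_right (mul_le_mul_of_nonneg_left
    (Real.rpow_le_rpow_of_exponent_le hγ he) hΓ) (lpN_nonneg i s f))

/-- **MINKOWSKI** for b04's norms: `‖f + g‖_p ≤ ‖f‖_p + ‖g‖_p`, `s = 1/p ∈ [0,1]`. [folklore] -/
theorem lpN_add_le (f g : ↥i.R → ℝ) {s : ℝ} (hs0 : 0 ≤ s) (hs1 : s ≤ 1) :
    i.lpN s (f + g) ≤ i.lpN s f + i.lpN s g := by
  rcases hs0.eq_or_lt with hs | hs
  · subst hs
    unfold ZeroFieldCube.lpN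
    rw [if_pos rfl, if_pos rfl, if_pos rfl]
    refine supN_le_of_forall i (f + g) (add_nonneg (supN_nonneg_cube i f) (supN_nonneg_cube i g)) fun x => ?_
    rw [Pi.add_apply]
    exact (abs_add_le _ _).trans (add_le_add (abs_le_supN_cube i f x) (abs_le_supN_cube i g x))
  · have hn : (0 : ℝ) < i.n := by exact_mod_cast i.hn
    have hw : 0 ≤ ((1 : ℝ) / i.n) ^ (d + 1) := by positivity
    have hp : 1 ≤ 1 / s := one_le_one_div hs hs1
    have hM := Real.Lp_add_le (Finset.univ : Finset ↥i.R) f g hp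
    rw [one_div_one_div] at hM
    have hF : 0 ≤ ∑ x, |f x| ^ (1 / s) := Finset.sum_nonneg fun x _ => Real.rpow_nonneg (abs_nonneg _) _
    have hG : 0 ≤ ∑ x, |g x| ^ (1 / s) := Finset.sum_nonneg fun x _ => Real.rpow_nonneg (abs_nonneg _) _
    have hFG : 0 ≤ ∑ x, |f x + g x| ^ (1 / s) :=
      Finset.sum_nonneg fun x _ => Real.rpow_nonneg (abs_nonneg _) _
    unfold ZeroFieldCube.lpN
    rw [if_neg hs.ne', if_neg hs.ne', if_neg hs.ne']
    simp only [Pi.add_apply]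
    rw [Real.mul_rpow hw hFG, Real.mul_rpow hw hF, Real.mul_rpow hw hG, ← mul_add]
    exact mul_le_mul_of_nonneg_left hM (Real.rpow_nonneg hw _)

/-- monotonicity of a bound: `‖g‖ ≤ A‖f‖`, `A ≤ B` gives `‖g‖ ≤ B‖f‖`. [folklore] -/
theorem lpN_bound_mono {g f : ↥i.R → ℝ} {s t A B : ℝ} (h : i.lpN t g ≤ A * i.lpN s f) (hAB : A ≤ B) :
    i.lpN t g ≤ B * i.lpN s f :=
  h.trans (mul_le_mul_of_nonneg_right hAB (lpN_nonneg i s f))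

end Weighted

/-! ## §4 Kernels: the three kernels of (2.17) built from a matrix, entry/row/column bound packages -/

section Kernels

variable {X : Type*} [Fintype X]

/-- an ENTRY / ROW-SUM / COLUMN-SUM bound package for a kernel: `|T| ≤ E`, `Σ_x|T(x′,x)| ≤ R`, `Σ_{x′}|T(x′,x)| ≤ R`.
[folklore] -/
def PB (T : X → X → ℝ) (E R : ℝ) : Prop :=
  (∀ x' x, |T x' x| ≤ E) ∧ (∀ x', ∑ x, |T x' x| ≤ R) ∧ (∀ x, ∑ x', |T x' x| ≤ R)

/-- the package is monotone in the bounds. [folklore] -/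
theorem PB.mono {T : X → X → ℝ} {E R E' R' : ℝ} (h : PB T E R) (hE : E ≤ E') (hR : R ≤ R') : PB T E' R' :=
  ⟨fun x' x => (h.1 x' x).trans hE, fun x' => (h.2.1 x').trans hR, fun x => (h.2.2 x).trans hR⟩

/-- the package of the transposed kernel. [folklore] -/
theorem PB.transpose {T : X → X → ℝ} {E R : ℝ} (h : PB T E R) : PB (fun x' x => T x x') E R :=
  ⟨fun x' x => h.1 x x', fun x' => h.2.2 x', fun x => h.2.1 x⟩

variable {N : Fin (d + 1) → ℕ}

/-- **THE THREE KERNELS OF (2.17) BUILT FROM A MATRIX `T` ON THE BOX** (`n = L^k`, `fwd_μ` node 8's forward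
neighbour): `m = 0`: `T(x′,x)`; `m = 1`: `n(T(fwd_μx′,x) − T(x′,x))` (`D^η_μT`); `m = 2`: `n(T(x′,fwd_μx) − T(x′,x))`
(`T D^{η*}_μ`) — node 15's `kerY` is `kerOf` of `G_k(□,0)` (`kerY_eq_kerOf`). [folklore] -/
def kerOf (n : ℕ) (m : Fin 3) (μ : Fin (d + 1)) (T : Matrix ↥(boxDom N) ↥(boxDom N) ℝ) :
    ↥(boxDom N) → ↥(boxDom N) → ℝ :=
  if m = 0 then fun x' x => T x' x
  else if m = 1 then fun x' x => (n : ℝ) * (T (fwd N μ x') x - T x' x)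
  else fun x' x => (n : ℝ) * (T x' (fwd N μ x) - T x' x)

/-- the kernels are additive in the matrix. [folklore] -/
theorem kerOf_add (n : ℕ) (m : Fin 3) (μ : Fin (d + 1)) (A B : Matrix ↥(boxDom N) ↥(boxDom N) ℝ)
    (x' x : ↥(boxDom N)) : kerOf n m μ (A + B) x' x = kerOf n m μ A x' x + kerOf n m μ B x' x := by
  unfold kerOf
  split_ifs <;> simp only [Matrix.add_apply] <;> ring

/-- **FROM SIX SCALAR BOUNDS TO THE THREE PACKAGES**: if `|T| ≤ E₀`, rows and columns of `|T|` are `≤ R₀`, the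
differenced kernel `n(T(fwd x′,x) − T(x′,x))` has entries `≤ E₁`, rows `≤ R₁` and columns `≤ R₁`, and `T` is
SYMMETRIC, then `kerOf n m μ T` has the package `(max E₀ E₁, max R₀ R₁)` for every `m` — the kernel `m = 2` is the
transpose of the kernel `m = 1` («by duality argument», p. 583). [folklore] -/
theorem PB_kerOf (n : ℕ) (μ : Fin (d + 1)) {T : Matrix ↥(boxDom N) ↥(boxDom N) ℝ} (hT : T.IsSymm)
    {E₀ R₀ E₁ R₁ : ℝ} (h0 : PB (fun x' x => T x' x) E₀ R₀)
    (h1 : PB (fun x' x => (n : ℝ) * (T (fwd N μ x') x - T x' x)) E₁ R₁) (m : Fin 3) :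
    PB (kerOf n m μ T) (max E₀ E₁) (max R₀ R₁) := by
  unfold kerOf
  by_cases hm0 : m = 0
  · rw [if_pos hm0]
    exact h0.mono (le_max_left _ _) (le_max_left _ _)
  · rw [if_neg hm0]
    by_cases hm1 : m = 1
    · rw [if_pos hm1]
      exact h1.mono (le_max_right _ _) (le_max_right _ _)
    · rw [if_neg hm1]
      have heq : (fun x' x : ↥(boxDom N) => (n : ℝ) * (T x' (fwd N μ x) - T x' x))
          = fun x' x => (n : ℝ) * (T (fwd N μ x) x' - T x x') := by
        funext x' x
        rw [hT.apply (fwd N μ x) x', hT.apply x x']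
      rw [heq]
      exact h1.transpose.mono (le_max_right _ _) (le_max_right _ _)

end Kernels

/-! ## §5 The pieces of the multiscale expansion `G_k(□) = 𝒢_1 + Σ_{j<k}(𝒢_{j+1} − 𝒢_j)`: the six scalar bounds -/

section Pieces

variable {ℓ k j : ℕ} {M : Fin (d + 1) → ℕ} {a m2 : ℝ}

/-- double-sum bookkeeping: `Σ_{y′}Σ_y f(y)g(y,y′) ≤ F·G`. [folklore] -/
theorem sum2_le {β γ : Type*} [Fintype β] [Fintype γ] (f : β → ℝ) (g : β → γ → ℝ)
    (hf : ∀ y, 0 ≤ f y) {F G : ℝ} (hG0 : 0 ≤ G) (hF : ∑ y, f y ≤ F) (hG : ∀ y, ∑ y', g y y' ≤ G) :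
    ∑ y', ∑ y, f y * g y y' ≤ F * G := by
  rw [Finset.sum_comm]
  calc ∑ y, ∑ y', f y * g y y' = ∑ y, f y * ∑ y', g y y' := by simp_rw [Finset.mul_sum]
    _ ≤ ∑ y, f y * G := Finset.sum_le_sum fun y _ => mul_le_mul_of_nonneg_left (hG y) (hf y)
    _ = (∑ y, f y) * G := by rw [Finset.sum_mul]
    _ ≤ F * G := mul_le_mul_of_nonneg_right hF hG0

/-- the unit-lattice sum about a block label: `Σ_{y ∈ □^{(j)}} e^{−t|blk_{b_j}x − y|_∞} ≤ K_{d+1}(t)`. [folklore] -/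
theorem blk_sum_le (hj : j + 1 ≤ k) (M : Fin (d + 1) → ℕ) {t : ℝ} (ht : 0 < t) (x : ↥(boxDom (Nf ℓ k M))) :
    ∑ y : ↥(boxDom (Mj ℓ k M j)), Real.exp (-(t * supNorm (blk (bj ℓ j) x.1 - y.1)))
      ≤ latticeConst (d + 1) t :=
  rho_sumBound (Mj ℓ k M j) t ht ⟨blk (bj ℓ j) x.1, blk_bj_mem hj M x⟩

/-- the fine-lattice sum `Σ_{x′} e^{−t|x − x′|_∞} ≤ K_{d+1}(t)`. [folklore] -/
theorem fine_sum_le (N : Fin (d + 1) → ℕ) {t : ℝ} (ht : 0 < t) (x : ↥(boxDom N)) :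
    ∑ x' : ↥(boxDom N), Real.exp (-(t * supNorm (x.1 - x'.1))) ≤ latticeConst (d + 1) t :=
  rho_sumBound N t ht x

/-- … and about the second variable. [folklore] -/
theorem fine_sum_le' (N : Fin (d + 1) → ℕ) {t : ℝ} (ht : 0 < t) (x : ↥(boxDom N)) :
    ∑ x' : ↥(boxDom N), Real.exp (-(t * supNorm (x'.1 - x.1))) ≤ latticeConst (d + 1) t := by
  refine le_of_eq_of_le (Finset.sum_congr rfl fun x' _ => ?_) (fine_sum_le N ht x)
  rw [← B4TorusKernel.supNorm_neg, neg_sub]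

/-- `e^{−r|fwd_μx′ − x|} ≤ e^{r}·e^{−r|x′ − x|}` (`|x′ − x| ≤ |fwd x′ − x| + 1`). [folklore] -/
theorem exp_fwd_le {N : Fin (d + 1) → ℕ} {r : ℝ} (hr : 0 ≤ r) (μ : Fin (d + 1)) (x' x : ↥(boxDom N)) :
    Real.exp (-(r * supNorm ((fwd N μ x').1 - x.1))) ≤ Real.exp r * Real.exp (-(r * supNorm (x'.1 - x.1))) := by
  have h := supNorm_sub_le_sub_fwd μ x x'
  rw [← B4TorusKernel.supNorm_neg, neg_sub, show x.1 - (fwd N μ x').1 = -((fwd N μ x').1 - x.1) by abel,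
    B4TorusKernel.supNorm_neg] at h
  rw [← Real.exp_add]
  exact Real.exp_le_exp.2 (by nlinarith)

/-- `𝒢_{j+1} − 𝒢_j` is symmetric. [folklore] -/
theorem fluct_isSymm (ℓ k : ℕ) (M : Fin (d + 1) → ℕ) (j : ℕ) (a m2 : ℝ) :
    (Gfine ℓ k M (j + 1) a m2 - Gfine ℓ k M j a m2).IsSymm :=
  (Gfine_isSymm ℓ k M (j + 1) a m2).sub (Gfine_isSymm ℓ k M j a m2)

/-- `L^k = s_j·b_j` cast. [folklore] -/
theorem Lk_cast_eq (hj : j ≤ k) : (((ℓ + 1) ^ k : ℕ) : ℝ) = sc ℓ k j * ((bj ℓ j : ℕ) : ℝ) := by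
  rw [sc_mul_bj hj]
  push_cast
  ring

/-- **THE START PIECE `𝒢_1 = s_1^{-2}G_1(□)`**: entrywise exponential decay with the factor `s_1^{-2}` KEPT
(`s_1 = L^{k-1}`): `|𝒢_1(x,y)| ≤ s_1^{-2}C₀e^{−r|x−y|_∞}` on the window — node 6's base case (`Gfine_apply`,
`boxOpR_L_inv_decay`; at `k = 1`, `fineOp_top`). [folklore] -/
theorem start_decay (d ℓ : ℕ) (hℓ : 1 ≤ ℓ) (amin aplus m2plus : ℝ) (ha : 0 < amin) :
    ∃ r C₀ : ℝ, 0 < r ∧ 0 < C₀ ∧ ∀ (k : ℕ), 1 ≤ k → ∀ (a m2 : ℝ), amin ≤ a → a ≤ aplus → 0 ≤ m2 →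
      m2 ≤ m2plus → ∀ (M : Fin (d + 1) → ℕ), (∀ i, 1 ≤ M i) → ∀ x y : ↥(boxDom (Nf ℓ k M)),
        |Gfine ℓ k M 1 a m2 x y| ≤ (sc ℓ k 1 ^ 2)⁻¹ * C₀ * Real.exp (-(r * supNorm (x.1 - y.1))) := by
  obtain ⟨r, C₀, hr, hC₀, hdec⟩ := boxOpR_L_inv_decay d ℓ hℓ (amin * (1 - ((((ℓ : ℝ) + 1)) ^ 2)⁻¹))
    aplus m2plus (aminus'_pos hℓ ha)
  refine ⟨r, C₀, hr, hC₀, fun k hk a m2 h1 h2 h3 h4 M hM x y => ?_⟩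
  have ha0 : 0 < a := lt_of_lt_of_le ha h1
  obtain ⟨hw1, hw2, hapos⟩ := aSeq_window hℓ ha h1 h2 (le_refl 1)
  rcases Nat.lt_or_ge k 2 with hk2 | hk2
  · obtain rfl : k = 1 := by omega
    have hG : Gfine ℓ 1 M 1 a m2 = (boxOpR ((ℓ + 1) ^ 1) (B1.aSeq a ((ℓ : ℝ) + 1) 1) m2 M)⁻¹ := by
      unfold Gfine
      rw [fineOp_top]
    rw [hG, sc_self, one_pow, inv_one, one_mul]
    exact hdec ((ℓ + 1) ^ 1) (pow_one _) _ _ hw1 hw2 h3 h4 M x y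
  · have hs : 0 < sc ℓ k 1 ^ 2 := pow_pos (sc_pos ℓ k 1) 2
    have hm' : 0 ≤ m2 / sc ℓ k 1 ^ 2 := div_nonneg h3 hs.le
    have hm'' : m2 / sc ℓ k 1 ^ 2 ≤ m2plus := (div_le_self h3 (one_le_pow₀ (one_le_sc ℓ k 1))).trans h4
    rw [Gfine_apply hℓ (le_refl 1) hk2 hM ha0 h3 x y, abs_mul, abs_of_pos (inv_pos.2 hs), mul_assoc]
    exact mul_le_mul_of_nonneg_left (hdec (bj ℓ 1) (pow_one _) _ _ hw1 hw2 hm' hm'' (Mj ℓ k M 1)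
      ((ej ℓ k M 1 hk2).symm x) ((ej ℓ k M 1 hk2).symm y)) (inv_pos.2 hs).le

/-- bookkeeping for the start piece: `v ≤ u·c`, `u = s_1^{-2}C₀ ≥ 0`, `0 ≤ c ≤ B`, `1 ≤ n` give
`v ≤ C₀B·(n s_1^{-2})`. [folklore] -/
theorem start_arith {v u c B C₀ si n : ℝ} (hv : v ≤ u * c) (hu : u = si * C₀) (hsi : 0 ≤ si) (hC₀ : 0 ≤ C₀)
    (hc0 : 0 ≤ c) (hc : c ≤ B) (hn : 1 ≤ n) : v ≤ C₀ * B * (n * si) := by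
  subst hu
  have h1 : si * C₀ * c ≤ si * C₀ * B := mul_le_mul_of_nonneg_left hc (mul_nonneg hsi hC₀)
  have h2 : si * C₀ * B ≤ n * (si * C₀ * B) := le_mul_of_one_le_left (by
    have := mul_nonneg (mul_nonneg hsi hC₀) (hc0.trans hc); exact this) hn
  calc v ≤ si * C₀ * c := hv
    _ ≤ n * (si * C₀ * B) := h1.trans h2
    _ = C₀ * B * (n * si) := by ring

/-- **THE SCALAR BOUNDS OF THE START PIECE, `m = 0`**: with `C ≥ 0` uniform on the window, `𝒢_1` has entries, row
sums and column sums `≤ C·L^k s_1^{-2}` (`= C·L·s_1^{-1}`; the factor `L^k ≥ 1` is spent for uniformity with the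
differenced piece). [folklore] -/
theorem start_PB0 (d ℓ : ℕ) (hℓ : 1 ≤ ℓ) (amin aplus m2plus : ℝ) (ha : 0 < amin) :
    ∃ C : ℝ, 0 ≤ C ∧ ∀ (k : ℕ), 1 ≤ k → ∀ (a m2 : ℝ), amin ≤ a → a ≤ aplus → 0 ≤ m2 →
      m2 ≤ m2plus → ∀ (M : Fin (d + 1) → ℕ), (∀ i, 1 ≤ M i) →
        PB (fun x' x => Gfine ℓ k M 1 a m2 x' x)
          (C * ((((ℓ + 1) ^ k : ℕ) : ℝ) * (sc ℓ k 1 ^ 2)⁻¹)) (C * ((((ℓ + 1) ^ k : ℕ) : ℝ) * (sc ℓ k 1 ^ 2)⁻¹)) := by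
  obtain ⟨r, C₀, hr, hC₀, hdec⟩ := start_decay d ℓ hℓ amin aplus m2plus ha
  have hK0 : 0 ≤ latticeConst (d + 1) r := latticeConst_nonneg _ hr.le
  refine ⟨C₀ * (1 + latticeConst (d + 1) r), by positivity, fun k hk a m2 h1 h2 h3 h4 M hM => ?_⟩
  have hd := hdec k hk a m2 h1 h2 h3 h4 M hM
  have hn1 : (1 : ℝ) ≤ (((ℓ + 1) ^ k : ℕ) : ℝ) := by exact_mod_cast Nat.one_le_pow _ _ (by omega)
  have hs : 0 ≤ (sc ℓ k 1 ^ 2)⁻¹ := (inv_pos.2 (pow_pos (sc_pos ℓ k 1) 2)).le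
  have hu0 : 0 ≤ (sc ℓ k 1 ^ 2)⁻¹ * C₀ := mul_nonneg hs hC₀.le
  have hE : ∀ x y : ↥(boxDom (Nf ℓ k M)), |Gfine ℓ k M 1 a m2 x y| ≤ (sc ℓ k 1 ^ 2)⁻¹ * C₀ * 1 := fun x y =>
    (hd x y).trans (mul_le_mul_of_nonneg_left (Real.exp_le_one_iff.2
      (by nlinarith [supNorm_nonneg (x.1 - y.1), hr.le])) hu0)
  have hrow : ∀ x : ↥(boxDom (Nf ℓ k M)), ∑ y, |Gfine ℓ k M 1 a m2 x y|
      ≤ (sc ℓ k 1 ^ 2)⁻¹ * C₀ * latticeConst (d + 1) r := fun x =>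
    calc ∑ y, |Gfine ℓ k M 1 a m2 x y| ≤ ∑ y : ↥(boxDom (Nf ℓ k M)), (sc ℓ k 1 ^ 2)⁻¹ * C₀ * Real.exp (-(r * supNorm (x.1 - y.1))) :=
          Finset.sum_le_sum fun y _ => hd x y
      _ = (sc ℓ k 1 ^ 2)⁻¹ * C₀ * ∑ y : ↥(boxDom (Nf ℓ k M)), Real.exp (-(r * supNorm (x.1 - y.1))) := by rw [Finset.mul_sum]
      _ ≤ (sc ℓ k 1 ^ 2)⁻¹ * C₀ * latticeConst (d + 1) r := mul_le_mul_of_nonneg_left (fine_sum_le _ hr x) hu0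
  have hcol : ∀ y : ↥(boxDom (Nf ℓ k M)), ∑ x, |Gfine ℓ k M 1 a m2 x y|
      ≤ (sc ℓ k 1 ^ 2)⁻¹ * C₀ * latticeConst (d + 1) r := fun y =>
    calc ∑ x, |Gfine ℓ k M 1 a m2 x y| ≤ ∑ x : ↥(boxDom (Nf ℓ k M)), (sc ℓ k 1 ^ 2)⁻¹ * C₀ * Real.exp (-(r * supNorm (x.1 - y.1))) :=
          Finset.sum_le_sum fun x _ => hd x y
      _ = (sc ℓ k 1 ^ 2)⁻¹ * C₀ * ∑ x : ↥(boxDom (Nf ℓ k M)), Real.exp (-(r * supNorm (x.1 - y.1))) := by rw [Finset.mul_sum]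
      _ ≤ (sc ℓ k 1 ^ 2)⁻¹ * C₀ * latticeConst (d + 1) r := mul_le_mul_of_nonneg_left (fine_sum_le' _ hr y) hu0
  exact ⟨fun x' x => start_arith (hE x' x) rfl hs hC₀.le zero_le_one (by linarith) hn1,
    fun x' => start_arith (hrow x') rfl hs hC₀.le hK0 (by linarith) hn1,
    fun x => start_arith (hcol x) rfl hs hC₀.le hK0 (by linarith) hn1⟩

/-- **THE SCALAR BOUNDS OF THE START PIECE, `m = 1`**: the fine difference quotient
`L^k(𝒢_1(fwd_μx′,x) − 𝒢_1(x′,x))` has entries, row sums and column sums `≤ C·L^k s_1^{-2}` (crudely: `|∇| ≤` two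
entries; for the columns `e^{−r|fwd x′ − x|} ≤ e^re^{−r|x′−x|}`). [folklore] -/
theorem start_PB1 (d ℓ : ℕ) (hℓ : 1 ≤ ℓ) (amin aplus m2plus : ℝ) (ha : 0 < amin) :
    ∃ C : ℝ, 0 ≤ C ∧ ∀ (k : ℕ), 1 ≤ k → ∀ (a m2 : ℝ), amin ≤ a → a ≤ aplus → 0 ≤ m2 →
      m2 ≤ m2plus → ∀ (M : Fin (d + 1) → ℕ), (∀ i, 1 ≤ M i) → ∀ (μ : Fin (d + 1)),
        PB (fun x' x => (((ℓ + 1) ^ k : ℕ) : ℝ) *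
            (Gfine ℓ k M 1 a m2 (fwd (Nf ℓ k M) μ x') x - Gfine ℓ k M 1 a m2 x' x))
          (C * ((((ℓ + 1) ^ k : ℕ) : ℝ) * (sc ℓ k 1 ^ 2)⁻¹)) (C * ((((ℓ + 1) ^ k : ℕ) : ℝ) * (sc ℓ k 1 ^ 2)⁻¹)) := by
  obtain ⟨r, C₀, hr, hC₀, hdec⟩ := start_decay d ℓ hℓ amin aplus m2plus ha
  have hK0 : 0 ≤ latticeConst (d + 1) r := latticeConst_nonneg _ hr.le
  have her : 1 ≤ Real.exp r := Real.one_le_exp hr.le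
  refine ⟨C₀ * (2 + (Real.exp r + 1) * latticeConst (d + 1) r), by positivity,
    fun k hk a m2 h1 h2 h3 h4 M hM μ => ?_⟩
  have hd := hdec k hk a m2 h1 h2 h3 h4 M hM
  have hn1 : (1 : ℝ) ≤ (((ℓ + 1) ^ k : ℕ) : ℝ) := by exact_mod_cast Nat.one_le_pow _ _ (by omega)
  have hn0 : (0 : ℝ) ≤ (((ℓ + 1) ^ k : ℕ) : ℝ) := by linarith
  have hs : 0 ≤ (sc ℓ k 1 ^ 2)⁻¹ := (inv_pos.2 (pow_pos (sc_pos ℓ k 1) 2)).le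
  have hu0 : 0 ≤ (sc ℓ k 1 ^ 2)⁻¹ * C₀ := mul_nonneg hs hC₀.le
  have hE : ∀ x y : ↥(boxDom (Nf ℓ k M)), |Gfine ℓ k M 1 a m2 x y| ≤ (sc ℓ k 1 ^ 2)⁻¹ * C₀ := fun x y =>
    (hd x y).trans (mul_le_of_le_one_right hu0 (Real.exp_le_one_iff.2
      (by nlinarith [supNorm_nonneg (x.1 - y.1), hr.le])))
  have hrow : ∀ x : ↥(boxDom (Nf ℓ k M)), ∑ y, |Gfine ℓ k M 1 a m2 x y|
      ≤ (sc ℓ k 1 ^ 2)⁻¹ * C₀ * latticeConst (d + 1) r := fun x =>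
    calc ∑ y, |Gfine ℓ k M 1 a m2 x y| ≤ ∑ y : ↥(boxDom (Nf ℓ k M)), (sc ℓ k 1 ^ 2)⁻¹ * C₀ * Real.exp (-(r * supNorm (x.1 - y.1))) :=
          Finset.sum_le_sum fun y _ => hd x y
      _ = (sc ℓ k 1 ^ 2)⁻¹ * C₀ * ∑ y : ↥(boxDom (Nf ℓ k M)), Real.exp (-(r * supNorm (x.1 - y.1))) := by rw [Finset.mul_sum]
      _ ≤ (sc ℓ k 1 ^ 2)⁻¹ * C₀ * latticeConst (d + 1) r := mul_le_mul_of_nonneg_left (fine_sum_le _ hr x) hu0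
  have hcol : ∀ y : ↥(boxDom (Nf ℓ k M)), ∑ x, |Gfine ℓ k M 1 a m2 x y|
      ≤ (sc ℓ k 1 ^ 2)⁻¹ * C₀ * latticeConst (d + 1) r := fun y =>
    calc ∑ x, |Gfine ℓ k M 1 a m2 x y| ≤ ∑ x : ↥(boxDom (Nf ℓ k M)), (sc ℓ k 1 ^ 2)⁻¹ * C₀ * Real.exp (-(r * supNorm (x.1 - y.1))) :=
          Finset.sum_le_sum fun x _ => hd x y
      _ = (sc ℓ k 1 ^ 2)⁻¹ * C₀ * ∑ x : ↥(boxDom (Nf ℓ k M)), Real.exp (-(r * supNorm (x.1 - y.1))) := by rw [Finset.mul_sum]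
      _ ≤ (sc ℓ k 1 ^ 2)⁻¹ * C₀ * latticeConst (d + 1) r := mul_le_mul_of_nonneg_left (fine_sum_le' _ hr y) hu0
  have hcolf : ∀ y : ↥(boxDom (Nf ℓ k M)), ∑ x, |Gfine ℓ k M 1 a m2 (fwd (Nf ℓ k M) μ x) y|
      ≤ (sc ℓ k 1 ^ 2)⁻¹ * C₀ * (Real.exp r * latticeConst (d + 1) r) := fun y =>
    calc ∑ x, |Gfine ℓ k M 1 a m2 (fwd (Nf ℓ k M) μ x) y|
        ≤ ∑ x : ↥(boxDom (Nf ℓ k M)), (sc ℓ k 1 ^ 2)⁻¹ * C₀ * (Real.exp r * Real.exp (-(r * supNorm (x.1 - y.1)))) :=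
          Finset.sum_le_sum fun x _ => (hd _ y).trans (mul_le_mul_of_nonneg_left (exp_fwd_le hr.le μ x y) hu0)
      _ = (sc ℓ k 1 ^ 2)⁻¹ * C₀ * (Real.exp r * ∑ x : ↥(boxDom (Nf ℓ k M)), Real.exp (-(r * supNorm (x.1 - y.1)))) := by
          rw [Finset.mul_sum, Finset.mul_sum]
      _ ≤ (sc ℓ k 1 ^ 2)⁻¹ * C₀ * (Real.exp r * latticeConst (d + 1) r) :=
          mul_le_mul_of_nonneg_left (mul_le_mul_of_nonneg_left (fine_sum_le' _ hr y) (Real.exp_pos r).le) hu0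
  -- `n·v ≤ C₀B(n s_1^{-2})` from `v ≤ u·c`
  have key : ∀ {v c : ℝ}, v ≤ (sc ℓ k 1 ^ 2)⁻¹ * C₀ * c → 0 ≤ c →
      c ≤ 2 + (Real.exp r + 1) * latticeConst (d + 1) r →
      (((ℓ + 1) ^ k : ℕ) : ℝ) * v ≤ C₀ * (2 + (Real.exp r + 1) * latticeConst (d + 1) r)
        * ((((ℓ + 1) ^ k : ℕ) : ℝ) * (sc ℓ k 1 ^ 2)⁻¹) := by
    intro v c hv hc0 hc
    calc (((ℓ + 1) ^ k : ℕ) : ℝ) * v ≤ (((ℓ + 1) ^ k : ℕ) : ℝ) * ((sc ℓ k 1 ^ 2)⁻¹ * C₀ * c) :=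
          mul_le_mul_of_nonneg_left hv hn0
      _ ≤ (((ℓ + 1) ^ k : ℕ) : ℝ) * ((sc ℓ k 1 ^ 2)⁻¹ * C₀ * (2 + (Real.exp r + 1) * latticeConst (d + 1) r)) :=
          mul_le_mul_of_nonneg_left (mul_le_mul_of_nonneg_left hc hu0) hn0
      _ = _ := by ring
  have habs : ∀ x' x : ↥(boxDom (Nf ℓ k M)),
      |(((ℓ + 1) ^ k : ℕ) : ℝ) * (Gfine ℓ k M 1 a m2 (fwd (Nf ℓ k M) μ x') x - Gfine ℓ k M 1 a m2 x' x)|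
        ≤ (((ℓ + 1) ^ k : ℕ) : ℝ) * (|Gfine ℓ k M 1 a m2 (fwd (Nf ℓ k M) μ x') x| + |Gfine ℓ k M 1 a m2 x' x|) :=
    fun x' x => by
      rw [abs_mul, abs_of_nonneg hn0]
      exact mul_le_mul_of_nonneg_left (abs_sub _ _) hn0
  refine ⟨fun x' x => (habs x' x).trans (key (c := 2) (by linarith [hE (fwd (Nf ℓ k M) μ x') x, hE x' x])
    zero_le_two (by nlinarith)), fun x' => ?_, fun x => ?_⟩
  · have hv : ∑ x, (|Gfine ℓ k M 1 a m2 (fwd (Nf ℓ k M) μ x') x| + |Gfine ℓ k M 1 a m2 x' x|)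
        ≤ (sc ℓ k 1 ^ 2)⁻¹ * C₀ * (latticeConst (d + 1) r + latticeConst (d + 1) r) := by
      rw [Finset.sum_add_distrib, mul_add]
      exact add_le_add (hrow _) (hrow x')
    calc ∑ x, |(((ℓ + 1) ^ k : ℕ) : ℝ) * (Gfine ℓ k M 1 a m2 (fwd (Nf ℓ k M) μ x') x - Gfine ℓ k M 1 a m2 x' x)|
        ≤ ∑ x, (((ℓ + 1) ^ k : ℕ) : ℝ) * (|Gfine ℓ k M 1 a m2 (fwd (Nf ℓ k M) μ x') x| + |Gfine ℓ k M 1 a m2 x' x|) :=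
          Finset.sum_le_sum fun x _ => habs x' x
      _ = (((ℓ + 1) ^ k : ℕ) : ℝ) * ∑ x, (|Gfine ℓ k M 1 a m2 (fwd (Nf ℓ k M) μ x') x| + |Gfine ℓ k M 1 a m2 x' x|) := by
          rw [Finset.mul_sum]
      _ ≤ _ := key hv (by positivity) (by nlinarith)
  · have hv : ∑ x', (|Gfine ℓ k M 1 a m2 (fwd (Nf ℓ k M) μ x') x| + |Gfine ℓ k M 1 a m2 x' x|)
        ≤ (sc ℓ k 1 ^ 2)⁻¹ * C₀ * (Real.exp r * latticeConst (d + 1) r + latticeConst (d + 1) r) := by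
      rw [Finset.sum_add_distrib, mul_add]
      exact add_le_add (hcolf x) (hcol x)
    calc ∑ x', |(((ℓ + 1) ^ k : ℕ) : ℝ) * (Gfine ℓ k M 1 a m2 (fwd (Nf ℓ k M) μ x') x - Gfine ℓ k M 1 a m2 x' x)|
        ≤ ∑ x', (((ℓ + 1) ^ k : ℕ) : ℝ) * (|Gfine ℓ k M 1 a m2 (fwd (Nf ℓ k M) μ x') x| + |Gfine ℓ k M 1 a m2 x' x|) :=
          Finset.sum_le_sum fun x' _ => habs x' x
      _ = (((ℓ + 1) ^ k : ℕ) : ℝ) * ∑ x', (|Gfine ℓ k M 1 a m2 (fwd (Nf ℓ k M) μ x') x| + |Gfine ℓ k M 1 a m2 x' x|) := by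
          rw [Finset.mul_sum]
      _ ≤ _ := key hv (by positivity) (by nlinarith)

/-- **ROW SUMS OF THE FLUCTUATION PIECE** `𝒢_{j+1} − 𝒢_j`: `Σ_{x′}|(𝒢_{j+1} − 𝒢_j)(x,x′)| ≤ Θ s_j^{-2}` — node 6's
step bound at weight rate `δ₀ = 0`. [folklore] -/
theorem fluct_row (d ℓ : ℕ) (hℓ : 1 ≤ ℓ) (amin aplus m2plus : ℝ) (ha : 0 < amin) :
    ∃ Θ : ℝ, 0 ≤ Θ ∧ ∀ (k j : ℕ), 1 ≤ j → ∀ (hj : j + 1 ≤ k), ∀ (a m2 : ℝ), amin ≤ a → a ≤ aplus → 0 ≤ m2 →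
      m2 ≤ m2plus → ∀ (M : Fin (d + 1) → ℕ), (∀ i, 1 ≤ M i) → ∀ x : ↥(boxDom (Nf ℓ k M)),
        ∑ x', |(Gfine ℓ k M (j + 1) a m2 - Gfine ℓ k M j a m2) x x'| ≤ Θ * (sc ℓ k j ^ 2)⁻¹ := by
  obtain ⟨κ₀, Θ, hκ₀, hΘ, h⟩ := step_term_bound d ℓ hℓ amin aplus m2plus ha
  refine ⟨Θ, hΘ, fun k j hj1 hj a m2 h1 h2 h3 h4 M hM x => ?_⟩
  have h' := h 0 le_rfl hκ₀.le k j hj1 hj a m2 h1 h2 h3 h4 M hM x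
  rw [Real.exp_zero, mul_one] at h'
  exact (rowSum_le_roww le_rfl _ _ x).trans h'

/-- **COLUMN SUMS OF THE FLUCTUATION PIECE** (by symmetry). [folklore] -/
theorem fluct_col (d ℓ : ℕ) (hℓ : 1 ≤ ℓ) (amin aplus m2plus : ℝ) (ha : 0 < amin) :
    ∃ Θ : ℝ, 0 ≤ Θ ∧ ∀ (k j : ℕ), 1 ≤ j → ∀ (hj : j + 1 ≤ k), ∀ (a m2 : ℝ), amin ≤ a → a ≤ aplus → 0 ≤ m2 →
      m2 ≤ m2plus → ∀ (M : Fin (d + 1) → ℕ), (∀ i, 1 ≤ M i) → ∀ x' : ↥(boxDom (Nf ℓ k M)),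
        ∑ x, |(Gfine ℓ k M (j + 1) a m2 - Gfine ℓ k M j a m2) x x'| ≤ Θ * (sc ℓ k j ^ 2)⁻¹ := by
  obtain ⟨Θ, hΘ, h⟩ := fluct_row d ℓ hℓ amin aplus m2plus ha
  refine ⟨Θ, hΘ, fun k j hj1 hj a m2 h1 h2 h3 h4 M hM x' => ?_⟩
  have hS := fluct_isSymm ℓ k M j a m2
  calc ∑ x, |(Gfine ℓ k M (j + 1) a m2 - Gfine ℓ k M j a m2) x x'|
      = ∑ x, |(Gfine ℓ k M (j + 1) a m2 - Gfine ℓ k M j a m2) x' x| :=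
        Finset.sum_congr rfl fun x _ => by rw [hS.apply x' x]
    _ ≤ Θ * (sc ℓ k j ^ 2)⁻¹ := h k j hj1 hj a m2 h1 h2 h3 h4 M hM x'

/-- **ROW SUMS OF THE DIFFERENCED FLUCTUATION PIECE**: `Σ_x L^k|(𝒢_{j+1} − 𝒢_j)(fwd_μx′,x) − (𝒢_{j+1} − 𝒢_j)(x′,x)|
≤ Θ s_j^{-1}` — node 7's differenced step bound at `δ₀ = 0` in the bond case of `fwd`, zero otherwise. [folklore] -/
theorem fluctD_row (d ℓ : ℕ) (hℓ : 1 ≤ ℓ) (amin aplus m2plus : ℝ) (ha : 0 < amin) :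
    ∃ Θ : ℝ, 0 ≤ Θ ∧ ∀ (k j : ℕ), 1 ≤ j → ∀ (hj : j + 1 ≤ k), ∀ (a m2 : ℝ), amin ≤ a → a ≤ aplus → 0 ≤ m2 →
      m2 ≤ m2plus → ∀ (M : Fin (d + 1) → ℕ), (∀ i, 1 ≤ M i) → ∀ (μ : Fin (d + 1)) (x' : ↥(boxDom (Nf ℓ k M))),
        ∑ x, |(((ℓ + 1) ^ k : ℕ) : ℝ) * ((Gfine ℓ k M (j + 1) a m2 - Gfine ℓ k M j a m2) (fwd (Nf ℓ k M) μ x') x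
            - (Gfine ℓ k M (j + 1) a m2 - Gfine ℓ k M j a m2) x' x)| ≤ Θ * (sc ℓ k j)⁻¹ := by
  obtain ⟨κ₀, Θ, hκ₀, hΘ, h⟩ := step_termD_bound d ℓ hℓ amin aplus m2plus ha
  refine ⟨Θ, hΘ, fun k j hj1 hj a m2 h1 h2 h3 h4 M hM μ x' => ?_⟩
  rcases fwd_spec μ x' with hf | hf
  · have h' := h 0 le_rfl hκ₀.le k j hj1 hj a m2 h1 h2 h3 h4 M hM μ x' (fwd (Nf ℓ k M) μ x') hf
    rw [Real.exp_zero, mul_one] at h'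
    exact (sum_abs_le_wsum le_rfl _ x' _).trans h'
  · rw [hf]
    simp only [sub_self, mul_zero, abs_zero, Finset.sum_const_zero]
    exact mul_nonneg hΘ (inv_pos.2 (sc_pos ℓ k j)).le

/-- **COLUMN SUMS OF THE DIFFERENCED FLUCTUATION PIECE**: `Σ_{x′} L^k|(𝒢_{j+1} − 𝒢_j)(fwd_μx′,x) − (𝒢_{j+1} −
𝒢_j)(x′,x)| ≤ Θ s_j^{-1}` — by symmetry this is node 8's column-differenced step bound at `δ₀ = 0` («by duality
argument»). [folklore] -/
theorem fluctD_col (d ℓ : ℕ) (hℓ : 1 ≤ ℓ) (amin aplus m2plus : ℝ) (ha : 0 < amin) :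
    ∃ Θ : ℝ, 0 ≤ Θ ∧ ∀ (k j : ℕ), 1 ≤ j → ∀ (hj : j + 1 ≤ k), ∀ (a m2 : ℝ), amin ≤ a → a ≤ aplus → 0 ≤ m2 →
      m2 ≤ m2plus → ∀ (M : Fin (d + 1) → ℕ), (∀ i, 1 ≤ M i) → ∀ (μ : Fin (d + 1)) (x : ↥(boxDom (Nf ℓ k M))),
        ∑ x', |(((ℓ + 1) ^ k : ℕ) : ℝ) * ((Gfine ℓ k M (j + 1) a m2 - Gfine ℓ k M j a m2) (fwd (Nf ℓ k M) μ x') x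
            - (Gfine ℓ k M (j + 1) a m2 - Gfine ℓ k M j a m2) x' x)| ≤ Θ * (sc ℓ k j)⁻¹ := by
  obtain ⟨κ₀, Θ, hκ₀, hΘ, h⟩ := step_termDcol_bound d ℓ hℓ amin aplus m2plus ha
  refine ⟨Θ, hΘ, fun k j hj1 hj a m2 h1 h2 h3 h4 M hM μ x => ?_⟩
  have h' := h 0 le_rfl hκ₀.le k j hj1 hj a m2 h1 h2 h3 h4 M hM μ x
  rw [Real.exp_zero, mul_one] at h'
  have hS := fluct_isSymm ℓ k M j a m2
  calc ∑ x', |(((ℓ + 1) ^ k : ℕ) : ℝ) * ((Gfine ℓ k M (j + 1) a m2 - Gfine ℓ k M j a m2) (fwd (Nf ℓ k M) μ x') x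
            - (Gfine ℓ k M (j + 1) a m2 - Gfine ℓ k M j a m2) x' x)|
      = ∑ x', |(((ℓ + 1) ^ k : ℕ) : ℝ) * ((Gfine ℓ k M (j + 1) a m2 - Gfine ℓ k M j a m2) x (fwd (Nf ℓ k M) μ x')
            - (Gfine ℓ k M (j + 1) a m2 - Gfine ℓ k M j a m2) x x')| :=
        Finset.sum_congr rfl fun x' _ => by rw [hS.apply x (fwd (Nf ℓ k M) μ x'), hS.apply x x']
    _ ≤ Θ * (sc ℓ k j)⁻¹ := (sum_abs_le_wsum le_rfl _ x _).trans h'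

/-- triple-sum bookkeeping with a pointwise third factor: `Σ_{y′}Σ_y f(y)g(y,y′)h(y′) ≤ F·G·H`. [folklore] -/
theorem sum2h_le {β γ : Type*} [Fintype β] [Fintype γ] (f : β → ℝ) (g : β → γ → ℝ) (h : γ → ℝ)
    (hf : ∀ y, 0 ≤ f y) (hg : ∀ y y', 0 ≤ g y y') {F G H : ℝ} (hG0 : 0 ≤ G) (hH0 : 0 ≤ H)
    (hF : ∑ y, f y ≤ F) (hG : ∀ y, ∑ y', g y y' ≤ G) (hH : ∀ y', h y' ≤ H) :
    ∑ y', ∑ y, f y * g y y' * h y' ≤ F * G * H := by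
  calc ∑ y', ∑ y, f y * g y y' * h y' ≤ ∑ y', ∑ y, f y * g y y' * H :=
        Finset.sum_le_sum fun y' _ => Finset.sum_le_sum fun y _ =>
          mul_le_mul_of_nonneg_left (hH y') (mul_nonneg (hf y) (hg y y'))
    _ = (∑ y', ∑ y, f y * g y y') * H := by rw [Finset.sum_mul]; simp_rw [Finset.sum_mul]
    _ ≤ F * G * H := mul_le_mul_of_nonneg_right (sum2_le f g hf hG0 hF hG) hH0

set_option maxHeartbeats 800000 in
/-- **ENTRIES OF THE FLUCTUATION PIECE**: `|(𝒢_{j+1} − 𝒢_j)(x,x′)| ≤ Θ s_j^{-2} b_j^{-(d+1)}` — from (2.34)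
`𝒢_{j+1} − 𝒢_j = α_j²A_jC_jB_j` with node 6's three entry bounds (block-row decay of `A_j`, `B_j` with the block
average `b_j^{-(d+1)}`, (2.37) decay of `C_j`). [folklore] -/
theorem fluct_entry (d ℓ : ℕ) (hℓ : 1 ≤ ℓ) (amin aplus m2plus : ℝ) (ha : 0 < amin) :
    ∃ Θ : ℝ, 0 ≤ Θ ∧ ∀ (k j : ℕ), 1 ≤ j → ∀ (hj : j + 1 ≤ k), ∀ (a m2 : ℝ), amin ≤ a → a ≤ aplus → 0 ≤ m2 →
      m2 ≤ m2plus → ∀ (M : Fin (d + 1) → ℕ), (∀ i, 1 ≤ M i) → ∀ x x' : ↥(boxDom (Nf ℓ k M)),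
        |(Gfine ℓ k M (j + 1) a m2 - Gfine ℓ k M j a m2) x x'|
          ≤ Θ * (sc ℓ k j ^ 2)⁻¹ * ((((bj ℓ j : ℕ) : ℝ)) ^ (d + 1))⁻¹ := by
  obtain ⟨κ, C₁, hκ, hC₁, hR⟩ := Gfine_blockRow_bound d ℓ hℓ amin aplus m2plus ha
  obtain ⟨δ, c₂, hδ, hc₂, hCov⟩ := cov237_box_decay d ℓ hℓ (amin * (1 - ((((ℓ : ℝ) + 1)) ^ 2)⁻¹)) aplus
    m2plus amin aplus (aminus'_pos hℓ ha) ha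
  have hKκ : 0 ≤ latticeConst (d + 1) κ := latticeConst_nonneg _ hκ.le
  have hKδ : 0 ≤ latticeConst (d + 1) δ := latticeConst_nonneg _ hδ.le
  refine ⟨aplus ^ 2 * (C₁ * c₂ * C₁) * (latticeConst (d + 1) κ * latticeConst (d + 1) δ), by positivity,
    fun k j hj1 hj a m2 h1 h2 h3 h4 M hM x x' => ?_⟩
  have ha0 : 0 < a := lt_of_lt_of_le ha h1
  obtain ⟨hw1, hw2, hapos⟩ := aSeq_window hℓ ha h1 h2 hj1
  have hs : 0 < sc ℓ k j ^ 2 := pow_pos (sc_pos ℓ k j) 2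
  have hsi : 0 < (sc ℓ k j ^ 2)⁻¹ := inv_pos.2 hs
  have hm' : 0 ≤ m2 / sc ℓ k j ^ 2 := div_nonneg h3 hs.le
  have hm'' : m2 / sc ℓ k j ^ 2 ≤ m2plus := (div_le_self h3 (one_le_pow₀ (one_le_sc ℓ k j))).trans h4
  have hb1 : 1 ≤ bj ℓ j := bj_pos ℓ j
  have hbD : (0 : ℝ) < ((bj ℓ j : ℕ) : ℝ) ^ (d + 1) := by positivity
  -- node 6's three entry bounds
  have hA : ∀ (x : ↥(boxDom (Nf ℓ k M))) (y : ↥(boxDom (Mj ℓ k M j))),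
      |Amat ℓ k M j a m2 x y|
        ≤ (sc ℓ k j ^ 2)⁻¹ * C₁ * Real.exp (-(κ * supNorm (blk (bj ℓ j) x.1 - y.1))) := by
    intro x y
    have hAxy : Amat ℓ k M j a m2 x y
        = ∑ x', (if blk (bj ℓ j) x'.1 = y.1 then Gfine ℓ k M j a m2 x x' else 0) := by
      simp only [Amat, Matrix.mul_apply, B4Thm110ZeroBox.QksM, Matrix.of_apply, mul_ite, mul_one, mul_zero]
    rw [hAxy]
    exact hR k j hj1 hj a m2 h1 h2 h3 h4 M hM x y.1 y.2
  have hB : ∀ (y' : ↥(boxDom (Mj ℓ k M j))) (x' : ↥(boxDom (Nf ℓ k M))),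
      |Bmat ℓ k M j a m2 y' x'| ≤ ((((bj ℓ j : ℕ) : ℝ)) ^ (d + 1))⁻¹ * ((sc ℓ k j ^ 2)⁻¹ * C₁) := by
    intro y' x'
    have hBe : Bmat ℓ k M j a m2 y' x' = ((((bj ℓ j : ℕ) : ℝ)) ^ (d + 1))⁻¹ *
        ∑ w, (if blk (bj ℓ j) w.1 = y'.1 then Gfine ℓ k M j a m2 x' w else 0) := by
      simp only [Bmat, Matrix.mul_apply, B4Thm110ZeroBox.QkM, Matrix.of_apply, Finset.mul_sum]
      refine Finset.sum_congr rfl fun w _ => ?_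
      split_ifs with hw
      · rw [(Gfine_isSymm ℓ k M j a m2).apply x' w]
      · rw [zero_mul, mul_zero]
    rw [hBe, abs_mul, abs_of_pos (inv_pos.2 hbD)]
    refine mul_le_mul_of_nonneg_left ((hR k j hj1 hj a m2 h1 h2 h3 h4 M hM x' y'.1 y'.2).trans
      (mul_le_of_le_one_right (mul_nonneg hsi.le hC₁) (Real.exp_le_one_iff.2
        (by nlinarith [supNorm_nonneg (blk (bj ℓ j) x'.1 - y'.1), hκ.le])))) (inv_pos.2 hbD).le
  have hC : ∀ (y y' : ↥(boxDom (Mj ℓ k M j))),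
      |Cmat ℓ k M j a m2 y y'| ≤ (sc ℓ k j ^ 2)⁻¹ * (c₂ * Real.exp (-(δ * supNorm (y.1 - y'.1)))) := by
    intro y y'
    have h := (hCov (bj ℓ j) hb1 _ _ a hw1 hw2 hm' hm'' h1 h2 (Mp ℓ k M j) (Mp_pos hM)).2 y y'
    rw [Cmat, Matrix.smul_apply, smul_eq_mul, abs_mul, abs_of_pos hsi]
    exact mul_le_mul_of_nonneg_left h hsi.le
  -- the three one-variable sums / sups
  have hF : ∑ y : ↥(boxDom (Mj ℓ k M j)), |Amat ℓ k M j a m2 x y|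
      ≤ (sc ℓ k j ^ 2)⁻¹ * C₁ * latticeConst (d + 1) κ :=
    calc ∑ y : ↥(boxDom (Mj ℓ k M j)), |Amat ℓ k M j a m2 x y|
        ≤ ∑ y : ↥(boxDom (Mj ℓ k M j)), (sc ℓ k j ^ 2)⁻¹ * C₁
            * Real.exp (-(κ * supNorm (blk (bj ℓ j) x.1 - y.1))) := Finset.sum_le_sum fun y _ => hA x y
      _ = (sc ℓ k j ^ 2)⁻¹ * C₁
            * ∑ y : ↥(boxDom (Mj ℓ k M j)), Real.exp (-(κ * supNorm (blk (bj ℓ j) x.1 - y.1))) := by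
          rw [Finset.mul_sum]
      _ ≤ (sc ℓ k j ^ 2)⁻¹ * C₁ * latticeConst (d + 1) κ :=
          mul_le_mul_of_nonneg_left (blk_sum_le hj M hκ x) (mul_nonneg hsi.le hC₁)
  have hG : ∀ y : ↥(boxDom (Mj ℓ k M j)), ∑ y' : ↥(boxDom (Mj ℓ k M j)), |Cmat ℓ k M j a m2 y y'|
      ≤ (sc ℓ k j ^ 2)⁻¹ * c₂ * latticeConst (d + 1) δ := fun y =>
    calc ∑ y' : ↥(boxDom (Mj ℓ k M j)), |Cmat ℓ k M j a m2 y y'|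
        ≤ ∑ y' : ↥(boxDom (Mj ℓ k M j)), (sc ℓ k j ^ 2)⁻¹ * (c₂ * Real.exp (-(δ * supNorm (y.1 - y'.1)))) :=
          Finset.sum_le_sum fun y' _ => hC y y'
      _ = (sc ℓ k j ^ 2)⁻¹ * c₂ * ∑ y' : ↥(boxDom (Mj ℓ k M j)), Real.exp (-(δ * supNorm (y.1 - y'.1))) := by
          rw [Finset.mul_sum]
          refine Finset.sum_congr rfl fun y' _ => ?_
          ring
      _ ≤ (sc ℓ k j ^ 2)⁻¹ * c₂ * latticeConst (d + 1) δ :=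
          mul_le_mul_of_nonneg_left (fine_sum_le _ hδ y) (mul_nonneg hsi.le hc₂.le)
  -- `α_j² ≤ a₊²·s_j^4`
  have hα : αj a ℓ k j ^ 2 ≤ aplus ^ 2 * (sc ℓ k j ^ 2) ^ 2 := by
    unfold αj
    rw [mul_pow]
    exact mul_le_mul_of_nonneg_right (pow_le_pow_left₀ hapos.le hw2 2) (by positivity)
  rw [Gfine_succ_sub hℓ hj1 hj hM ha0 h3, Matrix.smul_apply, smul_eq_mul, abs_mul, abs_of_nonneg (sq_nonneg _)]
  have hsum : |(Amat ℓ k M j a m2 * Cmat ℓ k M j a m2 * Bmat ℓ k M j a m2) x x'|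
      ≤ ((sc ℓ k j ^ 2)⁻¹ * C₁ * latticeConst (d + 1) κ) * ((sc ℓ k j ^ 2)⁻¹ * c₂ * latticeConst (d + 1) δ)
        * (((((bj ℓ j : ℕ) : ℝ)) ^ (d + 1))⁻¹ * ((sc ℓ k j ^ 2)⁻¹ * C₁)) := by
    simp only [Matrix.mul_apply, Finset.sum_mul]
    calc |∑ y', ∑ y, Amat ℓ k M j a m2 x y * Cmat ℓ k M j a m2 y y' * Bmat ℓ k M j a m2 y' x'|
        ≤ ∑ y', ∑ y, |Amat ℓ k M j a m2 x y| * |Cmat ℓ k M j a m2 y y'| * |Bmat ℓ k M j a m2 y' x'| := by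
          refine (Finset.abs_sum_le_sum_abs _ _).trans (Finset.sum_le_sum fun y' _ =>
            (Finset.abs_sum_le_sum_abs _ _).trans (le_of_eq (Finset.sum_congr rfl fun y _ => ?_)))
          rw [abs_mul, abs_mul]
      _ ≤ _ := sum2h_le (fun y => |Amat ℓ k M j a m2 x y|) (fun y y' => |Cmat ℓ k M j a m2 y y'|)
            (fun y' => |Bmat ℓ k M j a m2 y' x'|) (fun _ => abs_nonneg _) (fun _ _ => abs_nonneg _)
            (by positivity) (by positivity) hF hG (fun y' => hB y' x')
  calc αj a ℓ k j ^ 2 * |(Amat ℓ k M j a m2 * Cmat ℓ k M j a m2 * Bmat ℓ k M j a m2) x x'|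
      ≤ (aplus ^ 2 * (sc ℓ k j ^ 2) ^ 2) *
          (((sc ℓ k j ^ 2)⁻¹ * C₁ * latticeConst (d + 1) κ) * ((sc ℓ k j ^ 2)⁻¹ * c₂ * latticeConst (d + 1) δ)
            * (((((bj ℓ j : ℕ) : ℝ)) ^ (d + 1))⁻¹ * ((sc ℓ k j ^ 2)⁻¹ * C₁))) :=
        mul_le_mul hα hsum (abs_nonneg _) (by positivity)
    _ = aplus ^ 2 * (C₁ * c₂ * C₁) * (latticeConst (d + 1) κ * latticeConst (d + 1) δ) * (sc ℓ k j ^ 2)⁻¹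
          * ((((bj ℓ j : ℕ) : ℝ)) ^ (d + 1))⁻¹ := by
        field_simp

set_option maxHeartbeats 800000 in
/-- **ENTRIES OF THE DIFFERENCED FLUCTUATION PIECE**: for lattice neighbours `xe = x + e_μ` of the fine box,
`L^k|(𝒢_{j+1} − 𝒢_j)(xe,x′) − (𝒢_{j+1} − 𝒢_j)(x,x′)| ≤ Θ s_j^{-1} b_j^{-(d+1)}` — `mul3_row_sub` with node 7's
differenced block-row decay of `A_j` and node 6's bounds on `C_j`, `B_j`. [folklore] -/
theorem fluctD_entry (d ℓ : ℕ) (hℓ : 1 ≤ ℓ) (amin aplus m2plus : ℝ) (ha : 0 < amin) :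
    ∃ Θ : ℝ, 0 ≤ Θ ∧ ∀ (k j : ℕ), 1 ≤ j → ∀ (hj : j + 1 ≤ k), ∀ (a m2 : ℝ), amin ≤ a → a ≤ aplus → 0 ≤ m2 →
      m2 ≤ m2plus → ∀ (M : Fin (d + 1) → ℕ), (∀ i, 1 ≤ M i) →
        ∀ (μ : Fin (d + 1)) (x xe : ↥(boxDom (Nf ℓ k M))), xe.1 = x.1 + Pi.single μ 1 →
        ∀ x' : ↥(boxDom (Nf ℓ k M)),
          |(((ℓ + 1) ^ k : ℕ) : ℝ) * ((Gfine ℓ k M (j + 1) a m2 - Gfine ℓ k M j a m2) xe x'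
              - (Gfine ℓ k M (j + 1) a m2 - Gfine ℓ k M j a m2) x x')|
            ≤ Θ * (sc ℓ k j)⁻¹ * ((((bj ℓ j : ℕ) : ℝ)) ^ (d + 1))⁻¹ := by
  obtain ⟨κ, C₁, hκ, hC₁, hR⟩ := Gfine_blockRow_bound d ℓ hℓ amin aplus m2plus ha
  obtain ⟨κ', C', hκ', hC', hDf⟩ := Gfine_blockRowDiff_bound d ℓ hℓ amin aplus m2plus ha
  obtain ⟨δ, c₂, hδ, hc₂, hCov⟩ := cov237_box_decay d ℓ hℓ (amin * (1 - ((((ℓ : ℝ) + 1)) ^ 2)⁻¹)) aplus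
    m2plus amin aplus (aminus'_pos hℓ ha) ha
  have hKκ : 0 ≤ latticeConst (d + 1) κ' := latticeConst_nonneg _ hκ'.le
  have hKδ : 0 ≤ latticeConst (d + 1) δ := latticeConst_nonneg _ hδ.le
  refine ⟨aplus ^ 2 * (C' * c₂ * C₁) * (latticeConst (d + 1) κ' * latticeConst (d + 1) δ), by positivity,
    fun k j hj1 hj a m2 h1 h2 h3 h4 M hM μ x xe hxe x' => ?_⟩
  have ha0 : 0 < a := lt_of_lt_of_le ha h1
  obtain ⟨hw1, hw2, hapos⟩ := aSeq_window hℓ ha h1 h2 hj1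
  have hs : 0 < sc ℓ k j ^ 2 := pow_pos (sc_pos ℓ k j) 2
  have hsi : 0 < (sc ℓ k j ^ 2)⁻¹ := inv_pos.2 hs
  have hs1i : 0 < (sc ℓ k j)⁻¹ := inv_pos.2 (sc_pos ℓ k j)
  have hm' : 0 ≤ m2 / sc ℓ k j ^ 2 := div_nonneg h3 hs.le
  have hm'' : m2 / sc ℓ k j ^ 2 ≤ m2plus := (div_le_self h3 (one_le_pow₀ (one_le_sc ℓ k j))).trans h4
  have hb1 : 1 ≤ bj ℓ j := bj_pos ℓ j
  have hbD : (0 : ℝ) < ((bj ℓ j : ℕ) : ℝ) ^ (d + 1) := by positivity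
  -- the differenced block-row vector `g(y) = L^k(A_j(xe,y) − A_j(x,y))` (node 7)
  have hg : ∀ y : ↥(boxDom (Mj ℓ k M j)),
      |(((ℓ + 1) ^ k : ℕ) : ℝ) * (Amat ℓ k M j a m2 xe y - Amat ℓ k M j a m2 x y)|
        ≤ (sc ℓ k j)⁻¹ * C' * Real.exp (-(κ' * supNorm (blk (bj ℓ j) x.1 - y.1))) := by
    intro y
    have hAd : Amat ℓ k M j a m2 xe y - Amat ℓ k M j a m2 x y
        = ∑ x', (if blk (bj ℓ j) x'.1 = y.1 then
            Gfine ℓ k M j a m2 xe x' - Gfine ℓ k M j a m2 x x' else 0) := by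
      simp only [Amat, Matrix.mul_apply, B4Thm110ZeroBox.QksM, Matrix.of_apply, mul_ite, mul_one, mul_zero]
      rw [← Finset.sum_sub_distrib]
      refine Finset.sum_congr rfl fun x' _ => ?_
      split_ifs <;> ring
    rw [hAd]
    exact hDf k j hj1 hj a m2 h1 h2 h3 h4 M hM μ x xe hxe y.1 y.2
  have hB : ∀ (y' : ↥(boxDom (Mj ℓ k M j))) (x' : ↥(boxDom (Nf ℓ k M))),
      |Bmat ℓ k M j a m2 y' x'| ≤ ((((bj ℓ j : ℕ) : ℝ)) ^ (d + 1))⁻¹ * ((sc ℓ k j ^ 2)⁻¹ * C₁) := by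
    intro y' x'
    have hBe : Bmat ℓ k M j a m2 y' x' = ((((bj ℓ j : ℕ) : ℝ)) ^ (d + 1))⁻¹ *
        ∑ w, (if blk (bj ℓ j) w.1 = y'.1 then Gfine ℓ k M j a m2 x' w else 0) := by
      simp only [Bmat, Matrix.mul_apply, B4Thm110ZeroBox.QkM, Matrix.of_apply, Finset.mul_sum]
      refine Finset.sum_congr rfl fun w _ => ?_
      split_ifs with hw
      · rw [(Gfine_isSymm ℓ k M j a m2).apply x' w]
      · rw [zero_mul, mul_zero]
    rw [hBe, abs_mul, abs_of_pos (inv_pos.2 hbD)]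
    refine mul_le_mul_of_nonneg_left ((hR k j hj1 hj a m2 h1 h2 h3 h4 M hM x' y'.1 y'.2).trans
      (mul_le_of_le_one_right (mul_nonneg hsi.le hC₁) (Real.exp_le_one_iff.2
        (by nlinarith [supNorm_nonneg (blk (bj ℓ j) x'.1 - y'.1), hκ.le])))) (inv_pos.2 hbD).le
  have hC : ∀ (y y' : ↥(boxDom (Mj ℓ k M j))),
      |Cmat ℓ k M j a m2 y y'| ≤ (sc ℓ k j ^ 2)⁻¹ * (c₂ * Real.exp (-(δ * supNorm (y.1 - y'.1)))) := by
    intro y y'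
    have h := (hCov (bj ℓ j) hb1 _ _ a hw1 hw2 hm' hm'' h1 h2 (Mp ℓ k M j) (Mp_pos hM)).2 y y'
    rw [Cmat, Matrix.smul_apply, smul_eq_mul, abs_mul, abs_of_pos hsi]
    exact mul_le_mul_of_nonneg_left h hsi.le
  have hF : ∑ y : ↥(boxDom (Mj ℓ k M j)), |(((ℓ + 1) ^ k : ℕ) : ℝ) * (Amat ℓ k M j a m2 xe y - Amat ℓ k M j a m2 x y)|
      ≤ (sc ℓ k j)⁻¹ * C' * latticeConst (d + 1) κ' :=
    calc ∑ y : ↥(boxDom (Mj ℓ k M j)), |(((ℓ + 1) ^ k : ℕ) : ℝ) * (Amat ℓ k M j a m2 xe y - Amat ℓ k M j a m2 x y)|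
        ≤ ∑ y : ↥(boxDom (Mj ℓ k M j)), (sc ℓ k j)⁻¹ * C'
            * Real.exp (-(κ' * supNorm (blk (bj ℓ j) x.1 - y.1))) := Finset.sum_le_sum fun y _ => hg y
      _ = (sc ℓ k j)⁻¹ * C'
            * ∑ y : ↥(boxDom (Mj ℓ k M j)), Real.exp (-(κ' * supNorm (blk (bj ℓ j) x.1 - y.1))) := by
          rw [Finset.mul_sum]
      _ ≤ (sc ℓ k j)⁻¹ * C' * latticeConst (d + 1) κ' :=
          mul_le_mul_of_nonneg_left (blk_sum_le hj M hκ' x) (mul_nonneg hs1i.le hC')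
  have hG : ∀ y : ↥(boxDom (Mj ℓ k M j)), ∑ y' : ↥(boxDom (Mj ℓ k M j)), |Cmat ℓ k M j a m2 y y'|
      ≤ (sc ℓ k j ^ 2)⁻¹ * c₂ * latticeConst (d + 1) δ := fun y =>
    calc ∑ y' : ↥(boxDom (Mj ℓ k M j)), |Cmat ℓ k M j a m2 y y'|
        ≤ ∑ y' : ↥(boxDom (Mj ℓ k M j)), (sc ℓ k j ^ 2)⁻¹ * (c₂ * Real.exp (-(δ * supNorm (y.1 - y'.1)))) :=
          Finset.sum_le_sum fun y' _ => hC y y'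
      _ = (sc ℓ k j ^ 2)⁻¹ * c₂ * ∑ y' : ↥(boxDom (Mj ℓ k M j)), Real.exp (-(δ * supNorm (y.1 - y'.1))) := by
          rw [Finset.mul_sum]
          refine Finset.sum_congr rfl fun y' _ => ?_
          ring
      _ ≤ (sc ℓ k j ^ 2)⁻¹ * c₂ * latticeConst (d + 1) δ :=
          mul_le_mul_of_nonneg_left (fine_sum_le _ hδ y) (mul_nonneg hsi.le hc₂.le)
  have hα : αj a ℓ k j ^ 2 ≤ aplus ^ 2 * (sc ℓ k j ^ 2) ^ 2 := by
    unfold αj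
    rw [mul_pow]
    exact mul_le_mul_of_nonneg_right (pow_le_pow_left₀ hapos.le hw2 2) (by positivity)
  rw [Gfine_succ_sub hℓ hj1 hj hM ha0 h3, Matrix.smul_apply, Matrix.smul_apply, smul_eq_mul, smul_eq_mul,
    ← mul_sub, mul_left_comm, mul3_row_sub, abs_mul, abs_of_nonneg (sq_nonneg _)]
  have hsum : |∑ y', ∑ y, (((ℓ + 1) ^ k : ℕ) : ℝ) * (Amat ℓ k M j a m2 xe y - Amat ℓ k M j a m2 x y)
        * Cmat ℓ k M j a m2 y y' * Bmat ℓ k M j a m2 y' x'|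
      ≤ ((sc ℓ k j)⁻¹ * C' * latticeConst (d + 1) κ') * ((sc ℓ k j ^ 2)⁻¹ * c₂ * latticeConst (d + 1) δ)
        * (((((bj ℓ j : ℕ) : ℝ)) ^ (d + 1))⁻¹ * ((sc ℓ k j ^ 2)⁻¹ * C₁)) := by
    calc |∑ y', ∑ y, (((ℓ + 1) ^ k : ℕ) : ℝ) * (Amat ℓ k M j a m2 xe y - Amat ℓ k M j a m2 x y)
            * Cmat ℓ k M j a m2 y y' * Bmat ℓ k M j a m2 y' x'|
        ≤ ∑ y', ∑ y, |(((ℓ + 1) ^ k : ℕ) : ℝ) * (Amat ℓ k M j a m2 xe y - Amat ℓ k M j a m2 x y)|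
            * |Cmat ℓ k M j a m2 y y'| * |Bmat ℓ k M j a m2 y' x'| := by
          refine (Finset.abs_sum_le_sum_abs _ _).trans (Finset.sum_le_sum fun y' _ =>
            (Finset.abs_sum_le_sum_abs _ _).trans (le_of_eq (Finset.sum_congr rfl fun y _ => ?_)))
          rw [abs_mul, abs_mul]
      _ ≤ _ := sum2h_le (fun y => |(((ℓ + 1) ^ k : ℕ) : ℝ) * (Amat ℓ k M j a m2 xe y - Amat ℓ k M j a m2 x y)|)
            (fun y y' => |Cmat ℓ k M j a m2 y y'|)
            (fun y' => |Bmat ℓ k M j a m2 y' x'|) (fun _ => abs_nonneg _) (fun _ _ => abs_nonneg _)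
            (by positivity) (by positivity) hF hG (fun y' => hB y' x')
  calc αj a ℓ k j ^ 2 * |∑ y', ∑ y, (((ℓ + 1) ^ k : ℕ) : ℝ) * (Amat ℓ k M j a m2 xe y - Amat ℓ k M j a m2 x y)
            * Cmat ℓ k M j a m2 y y' * Bmat ℓ k M j a m2 y' x'|
      ≤ (aplus ^ 2 * (sc ℓ k j ^ 2) ^ 2) *
          (((sc ℓ k j)⁻¹ * C' * latticeConst (d + 1) κ') * ((sc ℓ k j ^ 2)⁻¹ * c₂ * latticeConst (d + 1) δ)
            * (((((bj ℓ j : ℕ) : ℝ)) ^ (d + 1))⁻¹ * ((sc ℓ k j ^ 2)⁻¹ * C₁))) :=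
        mul_le_mul hα hsum (abs_nonneg _) (by positivity)
    _ = aplus ^ 2 * (C' * c₂ * C₁) * (latticeConst (d + 1) κ' * latticeConst (d + 1) δ) * (sc ℓ k j)⁻¹
          * ((((bj ℓ j : ℕ) : ℝ)) ^ (d + 1))⁻¹ := by
        field_simp

end Pieces

/-! ## §6 The scaled packages of the pieces and the multiscale induction -/

section Multiscale

/-- `Γγ^d/(γb)^{d+1} = Γγ^{-1}b^{-(d+1)}`. [folklore] -/
theorem scaled_entry {Γ γ b : ℝ} (hγ : 0 < γ) (hb : 0 < b) (d : ℕ) :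
    Γ * γ ^ d / (γ * b) ^ (d + 1) = Γ * γ⁻¹ * (b ^ (d + 1))⁻¹ := by
  rw [mul_pow, pow_succ]
  field_simp

/-- `s^{-2} ≤ s^{-1}` for `s ≥ 1`. [folklore] -/
theorem sq_inv_le_inv {s : ℝ} (hs : 1 ≤ s) : (s ^ 2)⁻¹ ≤ s⁻¹ := by
  have h0 : 0 < s := by linarith
  rw [pow_two, mul_inv]
  exact mul_le_of_le_one_left (inv_pos.2 h0).le (inv_le_one_of_one_le₀ hs)

/-- monotone bookkeeping `Θu·w ≤ Γv·w`. [folklore] -/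
theorem mono3 {Θ Γ u v w : ℝ} (hΘ : Θ ≤ Γ) (hΘ0 : 0 ≤ Θ) (hu : u ≤ v) (hu0 : 0 ≤ u) (hw : 0 ≤ w) :
    Θ * u * w ≤ Γ * v * w :=
  mul_le_mul_of_nonneg_right (mul_le_mul hΘ hu hu0 (hΘ0.trans hΘ)) hw

/-- **THE SCALED PACKAGES OF THE PIECES** (one constant `Γ ≥ 0` for the whole window, every box, every `m, μ`):
with `n = L^k`, the three kernels of the START PIECE `𝒢_1` have entries `≤ Γs_1^d/n^{d+1}`, rows and columns `≤ Γ/s_1`,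
and those of the FLUCTUATION PIECE `𝒢_{j+1} − 𝒢_j` have entries `≤ Γs_j^d/n^{d+1}`, rows and columns `≤ Γ/s_j`
(`s_j = L^{k-j}`: in lattice units a kernel of magnitude `(s_j b_j^{d+1})^{-1}·s_j^{…}` and range `b_j = L^j`, i.e. the
scale-`L^jη` piece of B4 (2.40)). [folklore] -/
theorem pieces_PB (d ℓ : ℕ) (hℓ : 1 ≤ ℓ) (amin aplus m2plus : ℝ) (ha : 0 < amin) :
    ∃ Γ : ℝ, 0 ≤ Γ ∧ ∀ (k : ℕ), 1 ≤ k → ∀ (a m2 : ℝ), amin ≤ a → a ≤ aplus → 0 ≤ m2 → m2 ≤ m2plus →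
      ∀ (M : Fin (d + 1) → ℕ), (∀ i, 1 ≤ M i) → ∀ (m : Fin 3) (μ : Fin (d + 1)),
        PB (kerOf ((ℓ + 1) ^ k) m μ (Gfine ℓ k M 1 a m2))
          (Γ * sc ℓ k 1 ^ d / ((((ℓ + 1) ^ k : ℕ) : ℝ)) ^ (d + 1)) (Γ / sc ℓ k 1) ∧
        ∀ (j : ℕ), 1 ≤ j → j + 1 ≤ k →
          PB (kerOf ((ℓ + 1) ^ k) m μ (Gfine ℓ k M (j + 1) a m2 - Gfine ℓ k M j a m2))
            (Γ * sc ℓ k j ^ d / ((((ℓ + 1) ^ k : ℕ) : ℝ)) ^ (d + 1)) (Γ / sc ℓ k j) := by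
  obtain ⟨C0, hC0, hS0⟩ := start_PB0 d ℓ hℓ amin aplus m2plus ha
  obtain ⟨C1, hC1, hS1⟩ := start_PB1 d ℓ hℓ amin aplus m2plus ha
  obtain ⟨Θr, hΘr, hFr⟩ := fluct_row d ℓ hℓ amin aplus m2plus ha
  obtain ⟨Θc, hΘc, hFc⟩ := fluct_col d ℓ hℓ amin aplus m2plus ha
  obtain ⟨Θe, hΘe, hFe⟩ := fluct_entry d ℓ hℓ amin aplus m2plus ha
  obtain ⟨Θ₁, hΘ₁, hDe⟩ := fluctD_entry d ℓ hℓ amin aplus m2plus ha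
  obtain ⟨Θ₂, hΘ₂, hDr⟩ := fluctD_row d ℓ hℓ amin aplus m2plus ha
  obtain ⟨Θ₃, hΘ₃, hDc⟩ := fluctD_col d ℓ hℓ amin aplus m2plus ha
  have hL1 : (1 : ℝ) ≤ (ℓ : ℝ) + 1 := by linarith [(Nat.cast_nonneg ℓ : (0 : ℝ) ≤ ℓ)]
  have hL0 : (0 : ℝ) < (ℓ : ℝ) + 1 := L_real_pos ℓ
  have hΓ0 : 0 ≤ (C0 + C1) * ((ℓ : ℝ) + 1) ^ (d + 2) + (Θr + Θc + Θe + Θ₁ + Θ₂ + Θ₃) := by positivity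
  refine ⟨(C0 + C1) * ((ℓ : ℝ) + 1) ^ (d + 2) + (Θr + Θc + Θe + Θ₁ + Θ₂ + Θ₃), hΓ0,
    fun k hk a m2 h1 h2 h3 h4 M hM m μ => ⟨?_, fun j hj1 hj => ?_⟩⟩
  · -- the start piece, `n = s_1·L`
    have hs0 := sc_pos ℓ k 1
    have hs1 := one_le_sc ℓ k 1
    have hn : (((ℓ + 1) ^ k : ℕ) : ℝ) = sc ℓ k 1 * ((ℓ : ℝ) + 1) := by
      rw [Lk_cast_eq hk, bj_cast, pow_one]
    have hE : ((C0 + C1) * ((ℓ : ℝ) + 1) ^ (d + 2) + (Θr + Θc + Θe + Θ₁ + Θ₂ + Θ₃)) * sc ℓ k 1 ^ d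
          / ((((ℓ + 1) ^ k : ℕ) : ℝ)) ^ (d + 1)
        = ((C0 + C1) * ((ℓ : ℝ) + 1) ^ (d + 2) + (Θr + Θc + Θe + Θ₁ + Θ₂ + Θ₃)) * (sc ℓ k 1)⁻¹
          * ((((ℓ : ℝ) + 1)) ^ (d + 1))⁻¹ := by
      rw [hn]
      exact scaled_entry hs0 hL0 d
    have hA : (((ℓ + 1) ^ k : ℕ) : ℝ) * (sc ℓ k 1 ^ 2)⁻¹ = ((ℓ : ℝ) + 1) * (sc ℓ k 1)⁻¹ := by
      rw [hn]
      field_simp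
    -- the two scalar inequalities
    have hCe : ∀ {C : ℝ}, 0 ≤ C → C ≤ C0 + C1 → C * ((((ℓ + 1) ^ k : ℕ) : ℝ) * (sc ℓ k 1 ^ 2)⁻¹)
        ≤ ((C0 + C1) * ((ℓ : ℝ) + 1) ^ (d + 2) + (Θr + Θc + Θe + Θ₁ + Θ₂ + Θ₃)) * (sc ℓ k 1)⁻¹
          * ((((ℓ : ℝ) + 1)) ^ (d + 1))⁻¹ := by
      intro C hC0' hC
      rw [hA]
      have hLD : (0 : ℝ) < ((ℓ : ℝ) + 1) ^ (d + 1) := by positivity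
      have e1 : C * (((ℓ : ℝ) + 1) * (sc ℓ k 1)⁻¹)
          = C * ((ℓ : ℝ) + 1) ^ (d + 2) * (sc ℓ k 1)⁻¹ * ((((ℓ : ℝ) + 1)) ^ (d + 1))⁻¹ := by
        field_simp
        ring
      rw [e1]
      refine mono3 ?_ (by positivity) le_rfl (inv_pos.2 hs0).le (inv_pos.2 hLD).le
      nlinarith [pow_nonneg hL0.le (d + 2)]
    have hCr : ∀ {C : ℝ}, 0 ≤ C → C ≤ C0 + C1 → C * ((((ℓ + 1) ^ k : ℕ) : ℝ) * (sc ℓ k 1 ^ 2)⁻¹)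
        ≤ ((C0 + C1) * ((ℓ : ℝ) + 1) ^ (d + 2) + (Θr + Θc + Θe + Θ₁ + Θ₂ + Θ₃)) / sc ℓ k 1 := by
      intro C hC0' hC
      rw [hA, div_eq_mul_inv, ← mul_assoc]
      refine mul_le_mul_of_nonneg_right ?_ (inv_pos.2 hs0).le
      have hLp : (ℓ : ℝ) + 1 ≤ ((ℓ : ℝ) + 1) ^ (d + 2) := le_self_pow₀ hL1 (by omega)
      nlinarith [mul_le_mul hC hLp hL0.le (add_nonneg hC0 hC1)]
    rw [hE]
    have h0 := (hS0 k hk a m2 h1 h2 h3 h4 M hM).mono (hCe hC0 (by linarith)) (hCr hC0 (by linarith))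
    have h1' := (hS1 k hk a m2 h1 h2 h3 h4 M hM μ).mono (hCe hC1 (by linarith)) (hCr hC1 (by linarith))
    exact (PB_kerOf ((ℓ + 1) ^ k) μ (Gfine_isSymm ℓ k M 1 a m2) h0 h1' m).mono (max_self _).le (max_self _).le
  · -- the fluctuation piece, `n = s_j·b_j`
    have hs0 := sc_pos ℓ k j
    have hs1 := one_le_sc ℓ k j
    have hbD : (0 : ℝ) < ((bj ℓ j : ℕ) : ℝ) := by exact_mod_cast bj_pos ℓ j
    have hn : (((ℓ + 1) ^ k : ℕ) : ℝ) = sc ℓ k j * ((bj ℓ j : ℕ) : ℝ) := Lk_cast_eq (by omega)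
    have hE : ((C0 + C1) * ((ℓ : ℝ) + 1) ^ (d + 2) + (Θr + Θc + Θe + Θ₁ + Θ₂ + Θ₃)) * sc ℓ k j ^ d
          / ((((ℓ + 1) ^ k : ℕ) : ℝ)) ^ (d + 1)
        = ((C0 + C1) * ((ℓ : ℝ) + 1) ^ (d + 2) + (Θr + Θc + Θe + Θ₁ + Θ₂ + Θ₃)) * (sc ℓ k j)⁻¹
          * ((((bj ℓ j : ℕ) : ℝ)) ^ (d + 1))⁻¹ := by
      rw [hn]
      exact scaled_entry hs0 hbD d
    have hS : 0 ≤ (C0 + C1) * ((ℓ : ℝ) + 1) ^ (d + 2) := by positivity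
    have hsq : (sc ℓ k j ^ 2)⁻¹ ≤ (sc ℓ k j)⁻¹ := sq_inv_le_inv hs1
    have hsq0 : 0 ≤ (sc ℓ k j ^ 2)⁻¹ := by positivity
    have hsi0 : 0 ≤ (sc ℓ k j)⁻¹ := by positivity
    have hbi0 : 0 ≤ ((((bj ℓ j : ℕ) : ℝ)) ^ (d + 1))⁻¹ := by positivity
    -- generic: `Θ u [w] ≤ Γ s^{-1} [w]` for `Θ ≤ Γ`, `u ≤ s^{-1}`
    have hGe : ∀ {Θ u : ℝ}, 0 ≤ Θ → Θ ≤ Θr + Θc + Θe + Θ₁ + Θ₂ + Θ₃ → 0 ≤ u → u ≤ (sc ℓ k j)⁻¹ →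
        Θ * u * ((((bj ℓ j : ℕ) : ℝ)) ^ (d + 1))⁻¹
          ≤ ((C0 + C1) * ((ℓ : ℝ) + 1) ^ (d + 2) + (Θr + Θc + Θe + Θ₁ + Θ₂ + Θ₃)) * (sc ℓ k j)⁻¹
            * ((((bj ℓ j : ℕ) : ℝ)) ^ (d + 1))⁻¹ :=
      fun hΘ0 hΘ hu0 hu => mono3 (by linarith) hΘ0 hu hu0 hbi0
    have hGr : ∀ {Θ u : ℝ}, 0 ≤ Θ → Θ ≤ Θr + Θc + Θe + Θ₁ + Θ₂ + Θ₃ → 0 ≤ u → u ≤ (sc ℓ k j)⁻¹ →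
        Θ * u ≤ ((C0 + C1) * ((ℓ : ℝ) + 1) ^ (d + 2) + (Θr + Θc + Θe + Θ₁ + Θ₂ + Θ₃)) / sc ℓ k j := by
      intro Θ u hΘ0 hΘ hu0 hu
      rw [div_eq_mul_inv]
      exact mul_le_mul (by linarith) hu hu0 (hΘ0.trans (by linarith))
    rw [hE]
    have h0 : PB (fun x' x => (Gfine ℓ k M (j + 1) a m2 - Gfine ℓ k M j a m2) x' x)
        (((C0 + C1) * ((ℓ : ℝ) + 1) ^ (d + 2) + (Θr + Θc + Θe + Θ₁ + Θ₂ + Θ₃)) * (sc ℓ k j)⁻¹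
          * ((((bj ℓ j : ℕ) : ℝ)) ^ (d + 1))⁻¹)
        (((C0 + C1) * ((ℓ : ℝ) + 1) ^ (d + 2) + (Θr + Θc + Θe + Θ₁ + Θ₂ + Θ₃)) / sc ℓ k j) :=
      ⟨fun x' x => (hFe k j hj1 hj a m2 h1 h2 h3 h4 M hM x' x).trans (hGe hΘe (by linarith) hsq0 hsq),
        fun x' => (hFr k j hj1 hj a m2 h1 h2 h3 h4 M hM x').trans (hGr hΘr (by linarith) hsq0 hsq),
        fun x => (hFc k j hj1 hj a m2 h1 h2 h3 h4 M hM x).trans (hGr hΘc (by linarith) hsq0 hsq)⟩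
    have h1' : PB (fun x' x => (((ℓ + 1) ^ k : ℕ) : ℝ) *
          ((Gfine ℓ k M (j + 1) a m2 - Gfine ℓ k M j a m2) (fwd (Nf ℓ k M) μ x') x
            - (Gfine ℓ k M (j + 1) a m2 - Gfine ℓ k M j a m2) x' x))
        (((C0 + C1) * ((ℓ : ℝ) + 1) ^ (d + 2) + (Θr + Θc + Θe + Θ₁ + Θ₂ + Θ₃)) * (sc ℓ k j)⁻¹
          * ((((bj ℓ j : ℕ) : ℝ)) ^ (d + 1))⁻¹)
        (((C0 + C1) * ((ℓ : ℝ) + 1) ^ (d + 2) + (Θr + Θc + Θe + Θ₁ + Θ₂ + Θ₃)) / sc ℓ k j) := by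
      refine ⟨fun x' x => ?_,
        fun x' => (hDr k j hj1 hj a m2 h1 h2 h3 h4 M hM μ x').trans (hGr hΘ₂ (by linarith) hsi0 le_rfl),
        fun x => (hDc k j hj1 hj a m2 h1 h2 h3 h4 M hM μ x).trans (hGr hΘ₃ (by linarith) hsi0 le_rfl)⟩
      beta_reduce
      rcases fwd_spec μ x' with hf | hf
      · exact (hDe k j hj1 hj a m2 h1 h2 h3 h4 M hM μ x' (fwd (Nf ℓ k M) μ x') hf x).trans
          (hGe hΘ₁ (by linarith) hsi0 le_rfl)
      · rw [hf, sub_self, mul_zero, abs_zero]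
        exact mul_nonneg (mul_nonneg hΓ0 hsi0) hbi0
    exact (PB_kerOf ((ℓ + 1) ^ k) μ (fluct_isSymm ℓ k M j a m2) h0 h1' m).mono (max_self _).le (max_self _).le

/-- `s_j^e = ρ^{k−j}` with `ρ = L^e` (real exponent `e`). [folklore] -/
theorem sc_rpow (ℓ k j : ℕ) (e : ℝ) : sc ℓ k j ^ e = ((((ℓ : ℝ) + 1)) ^ e) ^ (k - j) := by
  have hL0 : (0 : ℝ) ≤ (ℓ : ℝ) + 1 := (L_real_pos ℓ).le
  unfold sc
  rw [← Real.rpow_natCast (((ℓ : ℝ) + 1)) (k - j), ← Real.rpow_mul hL0, mul_comm, Real.rpow_mul hL0,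
    Real.rpow_natCast]

/-- the geometric bookkeeping of the induction: `Γρ^{k-j}/(1−ρ) + Γρ^{k-j} ≤ Γρ^{k-j-1}/(1−ρ)` (`0 < ρ < 1`,
`j + 1 ≤ k`; i.e. `ρ(2 − ρ) ≤ 1`). [folklore] -/
theorem geom_step {Γ ρ : ℝ} (hΓ : 0 ≤ Γ) (hρ0 : 0 < ρ) (hρ1 : ρ < 1) {k j : ℕ} (hj : j + 1 ≤ k) :
    Γ / (1 - ρ) * ρ ^ (k - j) + Γ * ρ ^ (k - j) ≤ Γ / (1 - ρ) * ρ ^ (k - (j + 1)) := by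
  have hkj : k - j = (k - (j + 1)) + 1 := by omega
  rw [hkj, pow_succ]
  have hp : 0 ≤ ρ ^ (k - (j + 1)) := pow_nonneg hρ0.le _
  have h1ρ : 0 < 1 - ρ := by linarith
  rw [div_eq_mul_inv]
  have key : (1 - ρ)⁻¹ * ρ + ρ ≤ (1 - ρ)⁻¹ := by
    rw [← sub_nonneg]
    have : (1 - ρ)⁻¹ - ((1 - ρ)⁻¹ * ρ + ρ) = (1 - ρ)⁻¹ * (1 - ρ) ^ 2 - 0 := by
      field_simp
      ring
    rw [this, sub_zero]
    positivity
  nlinarith [mul_le_mul_of_nonneg_left key (mul_nonneg hΓ hp)]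

variable {ℓ : ℕ} {m2plus : ℝ}

/-- **THE MULTISCALE `L^p → L^q` BOUND** (running coefficient): for `e < 0` there is `c ≥ 0` (depending on `d, ℓ`,
the window and `e` only) such that for every instance `i` (box `T^{(k)}_1`, `η = L^{-k}`, `m²η² ≤ m²₊`), every
`1 ≤ j ≤ k`, every kernel `m ∈ {0,1,2}`, axis `μ`, and all `0 ≤ t ≤ s ≤ 1` with `s − t < 1`, `(d+1)(s−t) − 1 ≤ e`:
`‖T^{(m)}[𝒢_j]f‖_{1/t} ≤ c·ρ^{k−j}‖f‖_{1/s} ≤ c‖f‖_{1/s}` (`ρ = L^e < 1`) — kernel Young per piece (`lpN_young_scaled`,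
`pieces_PB`), summed along `𝒢_j = 𝒢_1 + Σ_{i<j}(𝒢_{i+1} − 𝒢_i)` by Minkowski; at `j = k`, `𝒢_k = G_k(□)`.
[cite: Balaban1983RegularityDecay, Lemma 2.2 (2.17) p. 578 via (2.40) p. 583, case Ã = 0, Ω = T^{(k)}_1] -/
theorem Gfine_lpN_bound (hℓ : 1 ≤ ℓ) (amin aplus : ℝ) (ha : 0 < amin) {e : ℝ} (he0 : e < 0) :
    ∃ c : ℝ, 0 ≤ c ∧ ∀ (i : BoxInst d ℓ m2plus) (a : ℝ), amin ≤ a → a ≤ aplus →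
      ∀ (j : ℕ), 1 ≤ j → j ≤ i.k → ∀ (m : Fin 3) (μ : Fin (d + 1)) (f g : ↥(toZFC i).R → ℝ),
        (∀ x', g x' = ∑ x, kerOf ((ℓ + 1) ^ i.k) m μ (Gfine ℓ i.k i.M j a i.m2) x' x * f x) →
        ∀ (s t : ℝ), 0 ≤ t → t ≤ s → s ≤ 1 → s - t < 1 → ((d : ℝ) + 1) * (s - t) - 1 ≤ e →
          (toZFC i).lpN t g ≤ c * (toZFC i).lpN s f := by
  obtain ⟨Γ, hΓ, hP⟩ := pieces_PB d ℓ hℓ amin aplus m2plus ha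
  have hL1 : (1 : ℝ) < (ℓ : ℝ) + 1 := one_lt_L_real hℓ
  set ρ : ℝ := (((ℓ : ℝ) + 1)) ^ e with hρ
  have hρ0 : 0 < ρ := Real.rpow_pos_of_pos (L_real_pos ℓ) e
  have hρ1 : ρ < 1 := Real.rpow_lt_one_of_one_lt_of_neg hL1 he0
  have h1ρ : 0 < 1 - ρ := by linarith
  refine ⟨Γ / (1 - ρ), div_nonneg hΓ h1ρ.le, fun i a h1 h2 => ?_⟩
  have hPi := hP i.k i.hk a i.m2 h1 h2 i.hm i.hm' i.M i.hM
  -- the claim with the geometric factor `ρ^{k-j}`, by induction on `j`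
  have claim : ∀ (j : ℕ), 1 ≤ j → j ≤ i.k → ∀ (m : Fin 3) (μ : Fin (d + 1)) (f g : ↥(toZFC i).R → ℝ),
      (∀ x', g x' = ∑ x, kerOf ((ℓ + 1) ^ i.k) m μ (Gfine ℓ i.k i.M j a i.m2) x' x * f x) →
      ∀ (s t : ℝ), 0 ≤ t → t ≤ s → s ≤ 1 → s - t < 1 → ((d : ℝ) + 1) * (s - t) - 1 ≤ e →
        (toZFC i).lpN t g ≤ Γ / (1 - ρ) * ρ ^ (i.k - j) * (toZFC i).lpN s f := by
    intro j hj1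
    induction j, hj1 using Nat.le_induction with
    | base =>
      intro _ m μ f g hg s t ht hts hs1 hst he
      have hpb := (hPi m μ).1
      have hy := lpN_young_scaled (toZFC i) (kerOf ((ℓ + 1) ^ i.k) m μ (Gfine ℓ i.k i.M 1 a i.m2)) f g hg
        hΓ (one_le_sc ℓ i.k 1) hpb.1 hpb.2.1 hpb.2.2 ht hts hs1 hst he
      rw [sc_rpow] at hy
      refine hy.trans (mul_le_mul_of_nonneg_right ?_ (lpN_nonneg _ _ _))
      rw [div_eq_mul_inv]
      refine mul_le_mul_of_nonneg_right (le_mul_of_one_le_right hΓ ?_) (pow_nonneg hρ0.le _)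
      exact one_le_inv_iff₀.2 ⟨h1ρ, by linarith⟩
    | succ j hj1 ih =>
      intro hjk m μ f g hg s t ht hts hs1 hst he
      have hjk' : j + 1 ≤ i.k := hjk
      -- `T[𝒢_{j+1}]f = T[𝒢_j]f + T[𝒢_{j+1} − 𝒢_j]f`
      set g₁ : ↥(toZFC i).R → ℝ := fun x' => ∑ x, kerOf ((ℓ + 1) ^ i.k) m μ (Gfine ℓ i.k i.M j a i.m2) x' x * f x
        with hg₁
      set g₂ : ↥(toZFC i).R → ℝ :=
        fun x' => ∑ x, kerOf ((ℓ + 1) ^ i.k) m μ (Gfine ℓ i.k i.M (j + 1) a i.m2 - Gfine ℓ i.k i.M j a i.m2) x' x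
          * f x with hg₂
      have hsplit : g = g₁ + g₂ := by
        funext x'
        rw [hg x', Pi.add_apply, hg₁, hg₂, ← Finset.sum_add_distrib]
        refine Finset.sum_congr rfl fun x _ => ?_
        rw [← add_mul, ← kerOf_add, add_sub_cancel]
      have hb1 := ih (by omega) m μ f g₁ (fun x' => rfl) s t ht hts hs1 hst he
      have hpb := (hPi m μ).2 j hj1 hjk'
      have hb2 := lpN_young_scaled (toZFC i)
        (kerOf ((ℓ + 1) ^ i.k) m μ (Gfine ℓ i.k i.M (j + 1) a i.m2 - Gfine ℓ i.k i.M j a i.m2)) f g₂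
        (fun x' => rfl) hΓ (one_le_sc ℓ i.k j) hpb.1 hpb.2.1 hpb.2.2 ht hts hs1 hst he
      rw [sc_rpow] at hb2
      rw [hsplit]
      calc (toZFC i).lpN t (g₁ + g₂) ≤ (toZFC i).lpN t g₁ + (toZFC i).lpN t g₂ :=
            lpN_add_le _ _ _ ht (hts.trans hs1)
        _ ≤ Γ / (1 - ρ) * ρ ^ (i.k - j) * (toZFC i).lpN s f + Γ * ρ ^ (i.k - j) * (toZFC i).lpN s f :=
            add_le_add hb1 hb2
        _ = (Γ / (1 - ρ) * ρ ^ (i.k - j) + Γ * ρ ^ (i.k - j)) * (toZFC i).lpN s f := by ring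
        _ ≤ Γ / (1 - ρ) * ρ ^ (i.k - (j + 1)) * (toZFC i).lpN s f :=
            mul_le_mul_of_nonneg_right (geom_step hΓ hρ0 hρ1 hjk') (lpN_nonneg _ _ _)
  intro j hj1 hjk m μ f g hg s t ht hts hs1 hst he
  refine (claim j hj1 hjk m μ f g hg s t ht hts hs1 hst he).trans
    (mul_le_mul_of_nonneg_right ?_ (lpN_nonneg _ _ _))
  exact mul_le_of_le_one_right (div_nonneg hΓ h1ρ.le) (pow_le_one₀ hρ0.le hρ1.le)

end Multiscale

/-! ## §7 The top scale with the literal coefficient; Lemma 2.2 (2.17) at `Ã = 0` for boxes, all `1 ≤ p ≤ q ≤ ∞`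
with `1/p − 1/q ≤ 1/p₁ < 1/(d+1)`; the typed `B4.Lemma22Printed` on b04's box family -/

section Typed

variable {ℓ : ℕ} {m2plus : ℝ}

/-- node 15's three kernels of (2.17) ARE the kernels `kerOf` of `G_k(□,0) = (−Δ^{η,N}_□ + m² + aQ_k^*Q_k)^{-1}`.
[folklore] -/
theorem kerY_eq_kerOf (a : ℝ) (i : BoxInst d ℓ m2plus) (m : Fin 3) (μ : Fin (d + 1)) :
    kerY a i m μ = kerOf ((ℓ + 1) ^ i.k) m μ ((boxOpR ((ℓ + 1) ^ i.k) a i.m2 i.M)⁻¹) := rfl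

/-- **THE TOP SCALE WITH THE LITERAL COEFFICIENT**: `𝒢_k` at the running coefficient `a/c_k` is
`G_k(□,0) = (−Δ^{η,N}_□ + m² + aQ_k^*Q_k)^{-1}` with the literal `a` of (1.6) (`fineOp_top`, `aSeq_div_cK`:
`a_k(a/c_k) = a`). [cite: Balaban1983RegularityDecay, (1.6) p. 572; Balaban1982Higgs1, (2.15) p. 609] -/
theorem Gfine_top_coeff (hℓ : 1 ≤ ℓ) {k : ℕ} (hk : 1 ≤ k) (M : Fin (d + 1) → ℕ) (a m2 : ℝ) :
    Gfine ℓ k M k (a / cK ℓ k) m2 = (boxOpR ((ℓ + 1) ^ k) a m2 M)⁻¹ := by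
  unfold Gfine
  rw [fineOp_top, aSeq_div_cK hℓ hk]

/-- **B4 LEMMA 2.2 (2.17) AT `Ã = 0` FOR BOXES — ALL THREE VECTORS, THE FULL RANGE `1 ≤ p ≤ q ≤ ∞`,
`1/p − 1/q ≤ 1/p₁`, `p₁ > d+1`**: there is `c₂ > 0` depending on `d, ℓ, a, m²₊, p₁` only — NOT on the mesh
`η = L^{-k}`, the box, or `m² ≤ m²₊η^{-2}` — such that for every instance, every `Y ∈ {G_k(□,0),
D^η_μG_k(□,0), G_k(□,0)D^{η*}_μ}`, every `f` and all `0 ≤ t ≤ s ≤ 1` with `s − 1/p₁ ≤ t` (`s = 1/p`, `t = 1/q`):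
`‖Yf‖_{1/t} ≤ c₂‖f‖_{1/s}` in the `η`-weighted norms of (2.11) (`t = 0`: the sup norm). Route: the literal coefficient is
the running one of `a/c_k ∈ [a, a/(1 − L^{-2})]` (`Gfine_top_coeff`), then `Gfine_lpN_bound` at `j = k` with
`e = (d+1)/p₁ − 1 < 0` (`(d+1)(s−t) − 1 ≤ e`, `s − t ≤ 1/p₁ < 1`).
[cite: Balaban1983RegularityDecay, Lemma 2.2 (2.17) p. 578, case Ã = 0, Ω = T^{(k)}_1 (p. 583 (2.40)–(2.41))] -/
theorem lemma22_17_zero_box (hℓ : 1 ≤ ℓ) (a : ℝ) (ha : 0 < a) (p₁ : ℝ) (hp : (d : ℝ) + 1 < p₁) :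
    ∃ c₂ : ℝ, 0 < c₂ ∧ ∀ (i : BoxInst d ℓ m2plus) (s t : ℝ) (n : Fin 3) (μ : Fin (d + 1))
      (f : ↥(toZFC i).R → ℝ), 0 ≤ t → s ≤ 1 → s - 1 / p₁ ≤ t → t ≤ s →
        (toZFC i).lpN t ((toZFC i).opY a n μ f) ≤ c₂ * (toZFC i).lpN s f := by
  have hD : (0 : ℝ) < (d : ℝ) + 1 := by positivity
  have hp0 : 0 < p₁ := hD.trans hp
  have he0 : ((d : ℝ) + 1) / p₁ - 1 < 0 := by
    rw [sub_neg, div_lt_one hp0]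
    exact hp
  obtain ⟨hr0, hr1⟩ := Linv_sq_bounds hℓ
  obtain ⟨c, hc, h⟩ := Gfine_lpN_bound (d := d) (m2plus := m2plus) hℓ a
    (a / (1 - ((((ℓ : ℝ) + 1)) ^ 2)⁻¹)) ha he0
  refine ⟨c + 1, by linarith, fun i s t n μ f ht hs1 hpt hts => ?_⟩
  have hk := i.hk
  have hcK := cK_pos hℓ hk
  have hA1 : a ≤ a / cK ℓ i.k := by
    rw [le_div_iff₀ hcK]
    exact mul_le_of_le_one_right ha.le (cK_le_one hℓ hk)
  have hA2 : a / cK ℓ i.k ≤ a / (1 - ((((ℓ : ℝ) + 1)) ^ 2)⁻¹) :=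
    div_le_div_of_nonneg_left ha.le (by linarith) (oneSub_le_cK hℓ hk)
  have hp1 : 1 / p₁ < 1 := by
    rw [div_lt_one hp0]
    linarith
  have hst : s - t < 1 := by linarith
  have hex : ((d : ℝ) + 1) * (s - t) - 1 ≤ ((d : ℝ) + 1) / p₁ - 1 := by
    have h1 : s - t ≤ 1 / p₁ := by linarith
    have h2 := mul_le_mul_of_nonneg_left h1 hD.le
    rw [mul_one_div] at h2
    linarith
  have hg : ∀ x', (toZFC i).opY a n μ f x'
      = ∑ x, kerOf ((ℓ + 1) ^ i.k) n μ (Gfine ℓ i.k i.M i.k (a / cK ℓ i.k) i.m2) x' x * f x := by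
    intro x'
    rw [opY_apply, Gfine_top_coeff hℓ hk, kerY_eq_kerOf]
  exact (h i (a / cK ℓ i.k) hA1 hA2 i.k hk le_rfl n μ f _ hg s t ht hts hs1 hst hex).trans
    (mul_le_mul_of_nonneg_right (by linarith) (lpN_nonneg _ _ _))

/-- **`B4.Lemma22Printed` — b04's TYPED LEMMA 2.2, BOTH CONJUNCTS VERBATIM, with its dimension parameter `d + 1` —
DISCHARGED ON THE ZERO-FIELD BOX FAMILY** `cubeFam ℓ m²₊ a Mb K` (every `ℓ ≥ 1`, `a > 0`, `m²₊`, `Mb`, `K`): conjunct 1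
((2.16)) is node 15's `lemma22Printed16_cubeFam`; conjunct 2 ((2.17), all three vectors, `d + 1 < p₁`,
`1 ≤ p ≤ q ≤ ∞`, `1/p − 1/q ≤ 1/p₁`) is `lemma22_17_zero_box`, with `e₁ = 1` and no typed antecedent used.
[cite: Balaban1983RegularityDecay, Lemma 2.2 (2.16)–(2.17) pp. 577–578, case Ã = 0, □ a box] -/
theorem lemma22Printed_cubeFam (hℓ : 1 ≤ ℓ) (a : ℝ) (ha : 0 < a) (Mb K : ℕ) :
    Lemma22Printed (cubeFam (d := d) ℓ m2plus a Mb K) (d + 1) := by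
  refine (lemma22Printed_iff _ _).2 ⟨lemma22Printed16_cubeFam hℓ a ha Mb K, fun p₁ hp => ?_⟩
  have hp' : (d : ℝ) + 1 < p₁ := by exact_mod_cast hp
  obtain ⟨c₂, hc₂, h⟩ := lemma22_17_zero_box (d := d) (m2plus := m2plus) hℓ a ha p₁ hp'
  exact ⟨c₂, 1, hc₂, one_pos, fun i _ _ _ _ _ _ s t n μ f ht hs1 hpt hts => h i s t n μ f ht hs1 hpt hts⟩

/-- AS TYPED, conjunct 2 on this family says exactly its THRESHOLD-FREE and ANTECEDENT-FREE form (given `e₁`, every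
member is met again with the charge `e₁`; `rect`, `regular`, `constNearBdry` hold identically; `fewLargeBlocks` is a
genuine restriction on the member and stays — `lemma22_17_zero_box` proves the clause WITHOUT it). [folklore] -/
theorem lemma22Printed17_cubeFam_iff_free (a : ℝ) (Mb K : ℕ) (d' : ℕ) :
    (∀ p₁ : ℝ, (d' : ℝ) < p₁ → ∃ c₂ e₁ : ℝ, 0 < c₂ ∧ 0 < e₁ ∧ ∀ i : BoxInst d ℓ m2plus,
        (cubeFam ℓ m2plus a Mb K i).rect → (cubeFam ℓ m2plus a Mb K i).fewLargeBlocks →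
        (cubeFam ℓ m2plus a Mb K i).regular → (cubeFam ℓ m2plus a Mb K i).constNearBdry →
        0 < (cubeFam ℓ m2plus a Mb K i).e → (cubeFam ℓ m2plus a Mb K i).e ≤ e₁ →
        ∀ (s t : ℝ) (n : Fin 3) (μ : (cubeFam ℓ m2plus a Mb K i).Dir) (f : (cubeFam ℓ m2plus a Mb K i).Src),
          0 ≤ t → s ≤ 1 → s - 1 / p₁ ≤ t → t ≤ s →
          (cubeFam ℓ m2plus a Mb K i).opLq n μ t f ≤ c₂ * (cubeFam ℓ m2plus a Mb K i).lpNorm s f) ↔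
      ∀ p₁ : ℝ, (d' : ℝ) < p₁ → ∃ c₂ : ℝ, 0 < c₂ ∧ ∀ i : BoxInst d ℓ m2plus,
        (cubeFam ℓ m2plus a Mb K i).fewLargeBlocks →
        ∀ (s t : ℝ) (n : Fin 3) (μ : (cubeFam ℓ m2plus a Mb K i).Dir) (f : (cubeFam ℓ m2plus a Mb K i).Src),
          0 ≤ t → s ≤ 1 → s - 1 / p₁ ≤ t → t ≤ s →
          (cubeFam ℓ m2plus a Mb K i).opLq n μ t f ≤ c₂ * (cubeFam ℓ m2plus a Mb K i).lpNorm s f := by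
  constructor
  · intro h p₁ hp
    obtain ⟨c₂, e₁, hc, he, h⟩ := h p₁ hp
    refine ⟨c₂, hc, fun i hfew s t n μ f ht hs1 hpt hts => ?_⟩
    exact h { i with e := e₁ } (rectC a Mb K _) hfew trivial trivial he le_rfl s t n μ f ht hs1 hpt hts
  · intro h p₁ hp
    obtain ⟨c₂, hc, h⟩ := h p₁ hp
    exact ⟨c₂, 1, hc, one_pos, fun i _ hfew _ _ _ _ s t n μ f ht hs1 hpt hts => h i hfew s t n μ f ht hs1 hpt hts⟩

end Typed

/-! ## §8 Non-vacuity: the typed statement instantiated and its index type inhabited by members meeting every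
antecedent at every scale -/

section NonVacuity

/-- the certified typed statement instantiated: `d + 1 = 4` (so `p₁ > 4`), `L = 2`, `m²₊ = 1`, `a = 1`, `Mb = 5`,
`K = 1`. [folklore] -/
example : Lemma22Printed (cubeFam (d := 3) 1 1 1 5 1) (3 + 1) :=
  lemma22Printed_cubeFam le_rfl 1 one_pos 5 1

/-- and for every threshold and every scale `k ≥ 1` its index type holds a member meeting all six typed antecedents
(node 15's `threshold_metC`): e.g. `k = 3` (`η = 1/8`), charge `≤ 1/2`. [folklore] -/
example : ∃ i : BoxInst 3 1 1, i.k = 3 ∧ (cubeFam 1 1 1 5 1 i).rect ∧ (cubeFam 1 1 1 5 1 i).fewLargeBlocks ∧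
    (cubeFam 1 1 1 5 1 i).regular ∧ (cubeFam 1 1 1 5 1 i).constNearBdry ∧ 0 < (cubeFam 1 1 1 5 1 i).e ∧
    (cubeFam 1 1 1 5 1 i).e ≤ 1 / 2 :=
  B4Lemma22ZeroBoxCube.threshold_metC zero_le_one 1 (by norm_num) le_rfl 3 (by norm_num) (by norm_num)

/-- the quantitative core instantiated off the diagonal: `d + 1 = 4`, `L = 2`, `a = 1`, `m²₊ = 1`, `p₁ = 5 > 4`, so e.g.
`p = 1`, `q = 5/4` (`s = 1`, `t = 4/5`) is in range for all three vectors. [folklore] -/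
example : ∃ c₂ : ℝ, 0 < c₂ ∧ ∀ (i : BoxInst 3 1 1) (n : Fin 3) (μ : Fin (3 + 1)) (f : ↥(toZFC i).R → ℝ),
    (toZFC i).lpN (4 / 5) ((toZFC i).opY 1 n μ f) ≤ c₂ * (toZFC i).lpN 1 f := by
  obtain ⟨c₂, hc, h⟩ := lemma22_17_zero_box (d := 3) (m2plus := 1) le_rfl 1 one_pos 5 (by norm_num)
  exact ⟨c₂, hc, fun i n μ f => h i 1 (4 / 5) n μ f (by norm_num) le_rfl (by norm_num) (by norm_num)⟩

end NonVacuity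

end

end Literature.MathematicalPhysics.QuantumFieldTheory.Balaban1983to89.B4Lemma22ZeroBoxLpLq
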